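import Literature.Geometry.Kaehler.ComplexTorusAnalyticClassesKunnethExtreme
import Literature.Geometry.Kaehler.ComplexTorusAnalyticLimitCycleClass
import Literature.Geometry.Kaehler.ComplexTorusAnalyticCycleClassNonzero
import Literature.Geometry.Kaehler.ComplexTorusAnalyticProperIntersectionTranslates
import HarnessLib

/-!
# Specialization of the generic fibre: every fibre of an analytic family over a complex torus carries
# an effective cycle with the restriction class `i₀^*[Z]`

Let `X₁ = E₁/Λ₁`, `X₂ = E₂/Λ₂` be complex tori (`dim X₂ > 0`) and `Z ⊆ X₁ × X₂` a closed analytic subset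
of pure dimension `q + 1 + dim X₂` — an analytic FAMILY of `(q+1)`-dimensional cycles of `X₁`
parametrised by `X₂`, with fibres `Z_t = {x | (x, t) ∈ Z}`. By `ComplexTorusAnalyticFibreClassConstant` /
`ComplexTorusAnalyticClassesKunnethExtreme`, for Haar-a.e. `t` the fibre `Z_t` is empty or of pure
dimension `q + 1`, with the constant class `cl_{e₁}(Z_t) = sign(e₁) sign(e) · i₀^*[Z]_e`. This file
SPECIALIZES the generic fibre class to EVERY parameter (Fulton, Ch. 10–11: the classes `[𝒱_t]` of the
fibres of a family agree, Cor. 10.1 / Prop. 10.2 "conservation of number", and the limit cycle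
`lim_{t → t₀} [Z_t]` is an effective cycle supported on the special fibre, §11.1):

* `ComplexTorus.mem_fibre_of_forall_mem_closure_iUnion_fibre` — limit points of the fibres `C_{t_j}`,
  `t_j → t₀`, of a closed `C ⊆ X₁ × T` lie in the fibre `C_{t₀}`.
* `ComplexTorus.exists_effectiveCycle_fibreSlice_eq_inl_pullback` — **for EVERY `t₀ ∈ X₂` there is an
  EFFECTIVE holomorphic `(q+1)`-chain `S ≥ 0` of `X₁` supported on the fibre `Z_{t₀}` with
  `cl_{e₁}(S) = sign(e₁) sign(e) · i₀^*[Z]_e`** (generic fibres `Z_{t_j}`, `t_j → t₀`, have the constant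
  class, hence constant volume (Wirtinger); Bishop's compactness in class form
  `exists_subseq_effectiveCycle_of_measure_le` gives the limit cycle, supported on the limit set `⊆ Z_{t₀}`).
* `ComplexTorus.compContinuousLinearMap_inl_analyticCycleClass_eq_zero_of_fibreSlice_eq_empty` — if ONE
  fibre is empty then `i₀^*[Z] = 0` (and then a.e. fibre is empty);
  `ComplexTorus.exists_irreducible_subset_fibreSlice_of_ne_zero`, `fibreSlice_nonempty_of_ne_zero` — if
  `i₀^*[Z] ≠ 0` then EVERY fibre contains an irreducible closed analytic subset of dimension `q + 1`; in
  particular `pr₂(Z) = X₂`.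

* §3 Over the first factor (through the transpose `ᵗZ ⊆ X₂ × X₁`,
  `smul_compContinuousLinearMap_inl_analyticCycleClass_preimage_swap`:
  `sign(e₂) sign(e₂ ⊔ e₁) · i₀'^*[ᵗZ] = sign(e₁) · i₁^*[Z]`): `exists_effectiveCycle_fstSlice_eq_inr_pullback` —
  every slice `Zˢ = {y | (s, y) ∈ Z}` of a `Z` of pure dimension `q + 1 + dim X₁` carries an effective cycle
  with class `sign(e₁) · i₁^*[Z]`; one empty slice kills `i₁^*[Z]`; `i₁^*[Z] ≠ 0 ⟹ pr₁(Z) = X₁`.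
* §4 In terms of the extreme Künneth components (`i₀^* K_0 = i₀^*`, `i₁^* K_k = i₁^*`, so `K_0 β = 0 ⟺
  i₀^*β = 0` and `K_k β = 0 ⟺ i₁^*β = 0`): **`K_0[Z] ≠ 0 ⟹ pr₂(Z) = X₂`** and **`K_{2p}[Z] ≠ 0 ⟹ pr₁(Z) = X₁`**.

* §5 THE SPECIAL FIBRE OF THE EXPECTED DIMENSION CARRIES THE WHOLE LIMIT CYCLE (Fulton §11.1: the limit
  cycle is supported on all proper components of the special fibre, with positive multiplicities): at a
  point `x₀ ∈ Z_{t₀}` where the fibre has dimension `≤ q + 1`, every neighbourhood of `x₀` meets `Z_t` for all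
  `t` near `t₀` (`eventually_nonempty_inter_fibreSlice` — Remmert's open mapping theorem, [Fischer1976, §3.9],
  for `pr₂` on `Z` at `(x₀, t₀)`, via `SCV.image_inter_mem_nhds_of_section` on the universal cover); hence if
  `Z_{t₀}` has the expected PURE dimension `q + 1`, the specialized cycle has support EXACTLY `Z_{t₀}`
  (**`exists_effectiveCycle_fibreSlice_eq_inl_pullback_support_eq`**), `i₀^*[Z] ≠ 0`
  (`compContinuousLinearMap_inl_analyticCycleClass_ne_zero_of_hasPureDim_fibreSlice`), and
  `sign · i₀^*[Z] = Σ_C m_C cl(C)` over the irreducible components `C` of `Z_{t₀}` with all `m_C ≥ 1`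
  (`exists_inl_pullback_eq_sum_isIrreducibleComponent_pos`).

* §6 PROPER POINTS OF AN ARBITRARY SPECIAL FIBRE: a single point `x₀ ∈ Z_{t₀}` at which the fibre has the
  expected dimension forces `i₀^*[Z] ≠ 0` (`compContinuousLinearMap_inl_analyticCycleClass_ne_zero_of_codim_le`),
  hence ALL fibres are non-empty (`forall_fibreSlice_nonempty_of_codim_le`: `pr₂(Z) = X₂`); and the specialized
  cycle can be chosen to contain every such point in its support
  (`exists_effectiveCycle_fibreSlice_eq_inl_pullback_support_supset`).

* §7 `i₀^*[Z] ≠ 0 ⟺ pr₂(Z) = X₂` (`compContinuousLinearMap_inl_analyticCycleClass_ne_zero_iff_forall_fibreSlice_nonempty`: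
  the restriction class is non-zero iff EVERY fibre is non-empty; Künneth form
  `kunnethComponent_zero_ne_zero_iff_forall_fibreSlice_nonempty`), and over the first factor
  `i₁^*[Z] ≠ 0 ⟺ pr₁(Z) = X₁` (`compContinuousLinearMap_inr_analyticCycleClass_ne_zero_iff_forall_fstSlice_nonempty`,
  `kunnethComponent_self_ne_zero_iff_forall_fstSlice_nonempty`).

The intersection cycle of `ComplexTorusAnalyticIntersectionCycle` is the case `Z = σ⁻¹(Y₁ × Y₂)`,
`t₀ = 0`. Theorems only; no definitions, no instances, no named facts.

## References

* [Fulton1998] W. Fulton, *Intersection Theory*, 2nd ed., Springer 1998, §10.1 (Cor. 10.1, Examples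
  10.1.1–10.1.2), §10.2 Prop. 10.2 (conservation of number), §11.1 (limit cycles).
* [Chirka1989] E. M. Chirka, *Complex Analytic Sets*, Kluwer 1989, §15.5 Cor., §16.1 Prop. 1.
* [Fischer1976] G. Fischer, *Complex Analytic Geometry*, LNM 538, Springer 1976, §3.9 Prop. (open mapping).
* [Fujiki1978] A. Fujiki, *Closedness of the Douady spaces of compact Kähler spaces*, Publ. RIMS 14
  (1978), §4 Prop. 4.1.
* [VoisinHodgeI2002] C. Voisin, *Hodge Theory and Complex Algebraic Geometry I*, CUP 2002, §3.1.3,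
  §11.1.2, §11.3.3 Thm. 11.38.
* [Lange2023AbelianVarietiesComplex] H. Lange, *Abelian Varieties over the Complex Numbers*, Springer
  2023, §6.2.2 p. 304 (the exchange of factors), §6.3.3 (6.14), Prop. 6.3.8.
-/

noncomputable section

open scoped Manifold Topology ENNReal NNReal
open MeasureTheory MeasureTheory.Measure Set Function Filter Module TopologicalSpace WithLp Metric Complex
open Literature.Geometry.GeometricMeasureTheory Literature.Analysis.Complex Literature.LinearAlgebra.Alternating

universe u

namespace Literature.Geometry.Kaehler

-- Nested operator-norm instances on `V [⋀^Fin m]→L[ℝ] F`, as in the tree's `Currents*.lean` files.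
set_option maxSynthPendingDepth 2

namespace ComplexTorus

/-! ### §1 Limit points of the fibres of a closed set -/

/-- **Limit points of the fibres `C_{t_j}` (`t_j → t₀`) of a closed `C ⊆ M × T` lie in the fibre `C_{t₀}`**:
a product neighbourhood `U × V` of `(z, t₀)` off `C` eventually contains the `t_j`, so `U` misses the
`C_{t_j}`. [cite: Fulton1998, §11.1 (the limit set lies in the special fibre)] -/
theorem mem_fibre_of_forall_mem_closure_iUnion_fibre {M T : Type*} [TopologicalSpace M] [TopologicalSpace T]
    {C : Set (M × T)} (hC : IsClosed C) {t : ℕ → T} {t₀ : T} (ht : Tendsto t atTop (𝓝 t₀)) {z : M}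
    (hz : ∀ N : ℕ, z ∈ closure (⋃ j ≥ N, {x : M | (x, t j) ∈ C})) : (z, t₀) ∈ C := by
  by_contra hzC
  obtain ⟨U, V, hU, hV, hzU, h0V, hUV⟩ := isOpen_prod_iff.1 hC.isOpen_compl z t₀ hzC
  obtain ⟨N, hN⟩ := eventually_atTop.1 (ht.eventually (hV.mem_nhds h0V))
  have hdisj : U ∩ (⋃ j ≥ N, {x : M | (x, t j) ∈ C}) = ∅ := by
    refine eq_empty_of_forall_notMem fun x hx ↦ ?_
    obtain ⟨hxU, hx⟩ := hx
    simp only [mem_iUnion, mem_setOf_eq, exists_prop] at hx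
    obtain ⟨j, hj, hxC⟩ := hx
    exact hUV (mk_mem_prod hxU (hN j hj)) hxC
  have hne := mem_closure_iff_nhds.1 (hz N) U (hU.mem_nhds hzU)
  rw [hdisj] at hne
  exact Set.not_nonempty_empty hne

/-! ### §2 Every fibre carries an effective cycle with the generic class -/

section Fibre

variable {ι₁ ι₂ : Type*} [Fintype ι₁] [Fintype ι₂] [DecidableEq ι₁] [DecidableEq ι₂]
  {E₁ : Type u} [NormedAddCommGroup E₁] [InnerProductSpace ℂ E₁] [FiniteDimensional ℂ E₁]
  [MeasurableSpace E₁] [BorelSpace E₁]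
  {E₂ : Type u} [NormedAddCommGroup E₂] [InnerProductSpace ℂ E₂] [FiniteDimensional ℂ E₂]
  [MeasurableSpace E₂] [BorelSpace E₂]
  (Φ₁ : (ι₁ → ℝ) ≃L[ℝ] E₁) (Φ₂ : (ι₂ → ℝ) ≃L[ℝ] E₂) {n₁ : ℕ} (e₁ : Fin n₁ ≃ ι₁) {p q : ℕ}

open Classical in
/-- **SPECIALIZATION OF THE GENERIC FIBRE CLASS.** For `Z ⊆ X₁ × X₂` closed analytic of pure dimension
`q + 1 + dim X₂` (`dim X₂ > 0`; an analytic family of `(q+1)`-cycles of `X₁` over `X₂`) and EVERY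
`t₀ ∈ X₂`, there is an effective holomorphic `(q+1)`-chain `S ≥ 0` of `X₁` SUPPORTED ON THE FIBRE
`Z_{t₀} = {x | (x, t₀) ∈ Z}` whose class is the generic fibre class, `cl_{e₁}(S) = sign(e₁) sign(e) · i₀^*[Z]_e`
(`i₀ : x ↦ (x, 0)`; all `i_t^*` agree). Fulton: the cycle classes of the fibres of a family all agree
(Cor. 10.1), the special fibre carrying the limit cycle (§11.1). Proof: generic fibres `Z_{t_j}`
(`t_j → t₀`, full-measure sets being dense) have pure dimension `q + 1`, the constant class and hence
constant volume; Bishop's compactness in class form yields the limit cycle, supported on the limit set,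
which lies in `Z_{t₀}` (`Z` closed). [cite: Fulton1998, §10.1 Cor. 10.1, §10.2 Prop. 10.2 and §11.1]
[cite: Chirka1989, §16.1 Prop. 1] [cite: Fujiki1978, §4 Prop. 4.1] -/
theorem exists_effectiveCycle_fibreSlice_eq_inl_pullback (hE₂ : 0 < finrank ℂ E₂) {n : ℕ} (e : Fin n ≃ ι₁ ⊕ ι₂)
    (h₁ : 2 * (q + 1) + 2 * p = n₁) (hk : 2 * (q + 1 + finrank ℂ E₂) + 2 * p = n)
    {Z : Set (ComplexTorus (prodPeriodL2 Φ₁ Φ₂))}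
    (hZ : HasPureDim 𝓘(ℂ, WithLp 2 (E₁ × E₂)) Z (q + 1 + finrank ℂ E₂)) (t₀ : ComplexTorus Φ₂) :
    ∃ S : HolomorphicChain 𝓘(ℂ, E₁) (ComplexTorus Φ₁) (q + 1), (∀ W, 0 ≤ S.mult W) ∧
      S.support ⊆ {x : ComplexTorus Φ₁ | (prodHomeomorphL2 Φ₁ Φ₂).symm (x, t₀) ∈ Z} ∧
        chainCycleClass Φ₁ e₁ h₁ S =
          ((orientationSign Φ₁ e₁ * orientationSign (prodPeriod Φ₁ Φ₂) e : ℤ) : ℂ) •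
            (analyticCycleClass (prodPeriodL2 Φ₁ Φ₂) e hk hZ).compContinuousLinearMap
              (realRep Φ₁ (prodPeriodL2 Φ₁ Φ₂) (inlMatrix ι₁ ι₂)) := by
  -- the generic class `R`
  have hcl := ae_volume_setCycleClass_fibreSlice_eq_inl_pullback Φ₁ Φ₂ e₁ hE₂ e (Nat.succ_pos q) h₁ hk hZ
  by_cases hR : ((orientationSign Φ₁ e₁ * orientationSign (prodPeriod Φ₁ Φ₂) e : ℤ) : ℂ) •
      (analyticCycleClass (prodPeriodL2 Φ₁ Φ₂) e hk hZ).compContinuousLinearMap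
        (realRep Φ₁ (prodPeriodL2 Φ₁ Φ₂) (inlMatrix ι₁ ι₂)) = 0
  · exact ⟨0, fun W ↦ by simp, by simp, by rw [chainCycleClass_zero, hR]⟩
  -- a.e. fibre is of pure dimension `q + 1` (the a.e.-empty alternative would force `R = 0`)
  have hpure : ∀ᵐ t ∂(volume : Measure (ComplexTorus Φ₂)),
      HasPureDim 𝓘(ℂ, E₁) {x : ComplexTorus Φ₁ | (prodHomeomorphL2 Φ₁ Φ₂).symm (x, t) ∈ Z} (q + 1) := by
    rcases ae_volume_fibreSlice_eq_empty_or_ae_volume_hasPureDim Φ₁ Φ₂ e₁ (p := p) (Nat.succ_pos q) h₁ hZ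
      with h | h
    · exfalso
      apply hR
      obtain ⟨t, ht, ht'⟩ := (h.and hcl).exists
      rw [← ht', ht, setCycleClass, dif_neg]
      exact fun hp ↦ hp.nonempty.ne_empty rfl
    · exact h
  -- a dense set of good parameters; a sequence of them tending to `t₀`
  have hdense := Measure.dense_of_ae (hpure.and hcl)
  obtain ⟨t, htG, ht0⟩ := mem_closure_iff_seq_limit.1 (hdense t₀)
  have hZt : ∀ j, HasPureDim 𝓘(ℂ, E₁)
      {x : ComplexTorus Φ₁ | (prodHomeomorphL2 Φ₁ Φ₂).symm (x, t j) ∈ Z} (q + 1) := fun j ↦ (htG j).1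
  have hclass : ∀ j, analyticCycleClass Φ₁ e₁ h₁ (hZt j) =
      ((orientationSign Φ₁ e₁ * orientationSign (prodPeriod Φ₁ Φ₂) e : ℤ) : ℂ) •
        (analyticCycleClass (prodPeriodL2 Φ₁ Φ₂) e hk hZ).compContinuousLinearMap
          (realRep Φ₁ (prodPeriodL2 Φ₁ Φ₂) (inlMatrix ι₁ ι₂)) := by
    intro j
    rw [← setCycleClass_of_hasPureDim Φ₁ e₁ h₁ (hZt j)]
    exact (htG j).2
  -- constant volume (Wirtinger)
  obtain ⟨V, hV⟩ : ∃ V : ℝ, ∀ j,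
      (μHE[2 * (q + 1)] : Measure E₁).real (periodBox Φ₁ 0 ∩ (analyticChain Φ₁ (hZt j)).carrier) = V := by
    refine ⟨(poincarePairing Φ₁ e₁ h₁ (ofRealCLM.compContinuousAlternatingMap (kaehlerPow (q + 1)))
      (((orientationSign Φ₁ e₁ * orientationSign (prodPeriod Φ₁ Φ₂) e : ℤ) : ℂ) •
        (analyticCycleClass (prodPeriodL2 Φ₁ Φ₂) e hk hZ).compContinuousLinearMap
          (realRep Φ₁ (prodPeriodL2 Φ₁ Φ₂) (inlMatrix ι₁ ι₂)))).re, fun j ↦ ?_⟩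
    have h := poincarePairing_kaehlerPow_analyticCycleClass Φ₁ e₁ h₁ (hZt j)
    rw [hclass j] at h
    rw [h, Complex.ofReal_re]
  have hvol : ∀ j, (μHE[2 * (q + 1)] : Measure E₁)
      (cover Φ₁ ⁻¹' {x : ComplexTorus Φ₁ | (prodHomeomorphL2 Φ₁ Φ₂).symm (x, t j) ∈ Z} ∩ periodBox Φ₁ 0) ≤
        ENNReal.ofReal V := by
    intro j
    have heq : (μHE[2 * (q + 1)] : Measure E₁)
        (cover Φ₁ ⁻¹' {x : ComplexTorus Φ₁ | (prodHomeomorphL2 Φ₁ Φ₂).symm (x, t j) ∈ Z} ∩ periodBox Φ₁ 0) =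
        (μHE[2 * (q + 1)] : Measure E₁) (periodBox Φ₁ 0 ∩ (analyticChain Φ₁ (hZt j)).carrier) := by
      rw [← image_val_liftSet, analyticChain,
        HolomorphicChain.measure_image_inter_eq_carrier_inter (hasPureDim_liftSet Φ₁ (hZt j)), inter_comm]
    rw [heq, ← ENNReal.ofReal_toReal (measure_periodBox_inter_carrier_lt_top Φ₁ (hZt j) 0).ne, ← measureReal_def,
      hV j]
  -- Bishop
  obtain ⟨κ, S, hκ, hS0, -, hsupp, hclS, -⟩ :=
    exists_subseq_effectiveCycle_of_measure_le Φ₁ hZt e₁ h₁ ENNReal.ofReal_lt_top hvol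
  refine ⟨S, hS0, fun z hz ↦ ?_, ?_⟩
  · -- the limit set lies in the special fibre: `Z' = {(x, t) | (x, t) ∈ Z}` is closed in `X₁ × X₂`
    have hC : IsClosed {w : ComplexTorus Φ₁ × ComplexTorus Φ₂ | (prodHomeomorphL2 Φ₁ Φ₂).symm w ∈ Z} :=
      hZ.isAnalyticSet.isClosed.preimage (prodHomeomorphL2 Φ₁ Φ₂).symm.continuous
    exact mem_fibre_of_forall_mem_closure_iUnion_fibre hC (ht0.comp hκ.tendsto_atTop) ((hsupp z).1 hz)
  · obtain ⟨j, hj⟩ := hclS.exists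
    rw [← hj, hclass]

open Classical in
/-- **One empty fibre kills the restriction class**: if some fibre `Z_{t₀}` of the family is empty then
`i₀^*[Z] = 0` (the effective cycle on `Z_{t₀}` with class `± i₀^*[Z]` is `0`); consequently a.e. fibre is
empty (`ae_fibreSlice_eq_empty_or_ae_hasPureDim`). Fulton, Prop. 10.2: the number (class) is conserved,
so it is `0` if one member is `0`. [cite: Fulton1998, §10.2 Prop. 10.2 and §11.1] [cite: Chirka1989, §16.1 Prop. 1] -/
theorem compContinuousLinearMap_inl_analyticCycleClass_eq_zero_of_fibreSlice_eq_empty (hE₂ : 0 < finrank ℂ E₂)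
    {n : ℕ} (e : Fin n ≃ ι₁ ⊕ ι₂) (hk : 2 * (q + 1 + finrank ℂ E₂) + 2 * p = n)
    {Z : Set (ComplexTorus (prodPeriodL2 Φ₁ Φ₂))}
    (hZ : HasPureDim 𝓘(ℂ, WithLp 2 (E₁ × E₂)) Z (q + 1 + finrank ℂ E₂)) {t₀ : ComplexTorus Φ₂}
    (h0 : {x : ComplexTorus Φ₁ | (prodHomeomorphL2 Φ₁ Φ₂).symm (x, t₀) ∈ Z} = ∅) :
    (analyticCycleClass (prodPeriodL2 Φ₁ Φ₂) e hk hZ).compContinuousLinearMap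
      (realRep Φ₁ (prodPeriodL2 Φ₁ Φ₂) (inlMatrix ι₁ ι₂)) = 0 := by
  -- an enumeration of the lattice basis of `X₁` in the right degree
  have hn : n = Fintype.card ι₁ + Fintype.card ι₂ := by rw [← Fintype.card_sum, ← Fintype.card_fin n]; exact Fintype.card_congr e
  have hng₂ : finrank ℂ E₂ * 2 = Fintype.card ι₂ := by
    rw [← Module.finrank_fintype_fun_eq_card (R := ℝ), Φ₂.toLinearEquiv.finrank_eq, finrank_real_of_complex, mul_comm]
  have h₁ : 2 * (q + 1) + 2 * p = Fintype.card ι₁ := by omega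
  set e₁' : Fin (Fintype.card ι₁) ≃ ι₁ := (Fintype.equivFin ι₁).symm with he₁'
  obtain ⟨S, hS0, hsupp, hcl⟩ :=
    exists_effectiveCycle_fibreSlice_eq_inl_pullback Φ₁ Φ₂ e₁' hE₂ e h₁ hk hZ t₀
  rw [h0, subset_empty_iff] at hsupp
  have hS : S.components ⊆ (∅ : Finset (Set (ComplexTorus Φ₁))) := by
    intro W hW
    obtain ⟨z, hz⟩ := (S.isIrreducibleAnalyticSet_and_hasPureDim hW).2.nonempty
    have : z ∈ S.support := HolomorphicChain.subset_support (HolomorphicChain.mem_components_iff.1 hW) hz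
    rw [hsupp] at this
    exact this.elim
  rw [chainCycleClass_eq_sum_of_subset Φ₁ e₁' h₁ S hS, Finset.sum_empty] at hcl
  have hss : ((orientationSign Φ₁ e₁' * orientationSign (prodPeriod Φ₁ Φ₂) e : ℤ) : ℂ) *
      ((orientationSign Φ₁ e₁' * orientationSign (prodPeriod Φ₁ Φ₂) e : ℤ) : ℂ) = 1 := by
    rcases orientationSign_eq_or Φ₁ e₁' with ha | ha <;> rcases orientationSign_eq_or (prodPeriod Φ₁ Φ₂) e with hb | hb <;>
      simp only [ha, hb] <;> norm_num
  have h := congrArg (((orientationSign Φ₁ e₁' * orientationSign (prodPeriod Φ₁ Φ₂) e : ℤ) : ℂ) • ·) hcl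
  simp only [smul_smul, hss, one_smul] at h
  rw [smul_zero] at h
  exact h.symm

open Classical in
/-- **A non-zero restriction class forces every fibre to contain a `(q+1)`-dimensional irreducible
analytic subset**: if `i₀^*[Z]_e ≠ 0` then for EVERY `t₀ ∈ X₂` the fibre `Z_{t₀}` contains an irreducible
closed analytic subset of dimension `q + 1` (a component of the specialized cycle).
[cite: Fulton1998, §10.1 Cor. 10.1 and §11.1] [cite: Chirka1989, §16.1 Prop. 1] -/
theorem exists_irreducible_subset_fibreSlice_of_ne_zero (hE₂ : 0 < finrank ℂ E₂) {n : ℕ} (e : Fin n ≃ ι₁ ⊕ ι₂)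
    (hk : 2 * (q + 1 + finrank ℂ E₂) + 2 * p = n) {Z : Set (ComplexTorus (prodPeriodL2 Φ₁ Φ₂))}
    (hZ : HasPureDim 𝓘(ℂ, WithLp 2 (E₁ × E₂)) Z (q + 1 + finrank ℂ E₂))
    (hne : (analyticCycleClass (prodPeriodL2 Φ₁ Φ₂) e hk hZ).compContinuousLinearMap
      (realRep Φ₁ (prodPeriodL2 Φ₁ Φ₂) (inlMatrix ι₁ ι₂)) ≠ 0) (t₀ : ComplexTorus Φ₂) :
    ∃ W ⊆ {x : ComplexTorus Φ₁ | (prodHomeomorphL2 Φ₁ Φ₂).symm (x, t₀) ∈ Z},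
      IsIrreducibleAnalyticSet 𝓘(ℂ, E₁) W ∧ HasPureDim 𝓘(ℂ, E₁) W (q + 1) := by
  -- an enumeration of the lattice basis of `X₁` in the right degree
  have hn : n = Fintype.card ι₁ + Fintype.card ι₂ := by
    rw [← Fintype.card_sum, ← Fintype.card_fin n]; exact Fintype.card_congr e
  have hng₂ : finrank ℂ E₂ * 2 = Fintype.card ι₂ := by
    rw [← Module.finrank_fintype_fun_eq_card (R := ℝ), Φ₂.toLinearEquiv.finrank_eq, finrank_real_of_complex, mul_comm]
  have h₁ : 2 * (q + 1) + 2 * p = Fintype.card ι₁ := by omega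
  set e₁' : Fin (Fintype.card ι₁) ≃ ι₁ := (Fintype.equivFin ι₁).symm with he₁'
  obtain ⟨S, hS0, hsupp, hcl⟩ := exists_effectiveCycle_fibreSlice_eq_inl_pullback Φ₁ Φ₂ e₁' hE₂ e h₁ hk hZ t₀
  by_cases hS : S.components = ∅
  · exfalso
    apply hne
    have hsub : S.components ⊆ (∅ : Finset (Set (ComplexTorus Φ₁))) := by rw [hS]; simp
    rw [chainCycleClass_eq_sum_of_subset Φ₁ e₁' h₁ S hsub, Finset.sum_empty] at hcl
    have hss : ((orientationSign Φ₁ e₁' * orientationSign (prodPeriod Φ₁ Φ₂) e : ℤ) : ℂ) *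
        ((orientationSign Φ₁ e₁' * orientationSign (prodPeriod Φ₁ Φ₂) e : ℤ) : ℂ) = 1 := by
      rcases orientationSign_eq_or Φ₁ e₁' with ha | ha <;>
        rcases orientationSign_eq_or (prodPeriod Φ₁ Φ₂) e with hb | hb <;> simp only [ha, hb] <;> norm_num
    have h := congrArg (((orientationSign Φ₁ e₁' * orientationSign (prodPeriod Φ₁ Φ₂) e : ℤ) : ℂ) • ·) hcl
    simp only [smul_smul, hss, one_smul] at h
    rw [smul_zero] at h
    exact h.symm
  · obtain ⟨W, hW⟩ := Set.nonempty_iff_ne_empty.2 hS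
    exact ⟨W, (HolomorphicChain.subset_support (HolomorphicChain.mem_components_iff.1 hW)).trans hsupp,
      S.isIrreducibleAnalyticSet_and_hasPureDim hW⟩

open Classical in
/-- **`i₀^*[Z] ≠ 0 ⟹ pr₂(Z) = X₂`**: every fibre of the family is non-empty.
[cite: Fulton1998, §10.1 Cor. 10.1 and §10.2 Prop. 10.2] -/
theorem fibreSlice_nonempty_of_ne_zero (hE₂ : 0 < finrank ℂ E₂) {n : ℕ} (e : Fin n ≃ ι₁ ⊕ ι₂)
    (hk : 2 * (q + 1 + finrank ℂ E₂) + 2 * p = n) {Z : Set (ComplexTorus (prodPeriodL2 Φ₁ Φ₂))}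
    (hZ : HasPureDim 𝓘(ℂ, WithLp 2 (E₁ × E₂)) Z (q + 1 + finrank ℂ E₂))
    (hne : (analyticCycleClass (prodPeriodL2 Φ₁ Φ₂) e hk hZ).compContinuousLinearMap
      (realRep Φ₁ (prodPeriodL2 Φ₁ Φ₂) (inlMatrix ι₁ ι₂)) ≠ 0) (t₀ : ComplexTorus Φ₂) :
    {x : ComplexTorus Φ₁ | (prodHomeomorphL2 Φ₁ Φ₂).symm (x, t₀) ∈ Z}.Nonempty := by
  obtain ⟨W, hW, -, hWd⟩ := exists_irreducible_subset_fibreSlice_of_ne_zero Φ₁ Φ₂ hE₂ e hk hZ hne t₀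
  exact hWd.nonempty.mono hW

/-! ### §3 Over the first factor: the transpose, `cl(S) = sign(e₁) · i₁^*[Z]` on every slice `Zˢ` -/

omit [DecidableEq ι₁] [DecidableEq ι₂] in
/-- The class does not see a re-reading `Fin m = Fin n` of the enumeration. [folklore] -/
private theorem analyticCycleClass_finCongr_trans₈ {ι : Type*} [Fintype ι] [DecidableEq ι] {E : Type u}
    [NormedAddCommGroup E] [InnerProductSpace ℂ E] [FiniteDimensional ℂ E] [MeasurableSpace E] [BorelSpace E]
    (Φ : (ι → ℝ) ≃L[ℝ] E) {m n d k : ℕ} (hmn : m = n) (e : Fin n ≃ ι) (hX : 2 * d + k = m) (hX' : 2 * d + k = n)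
    {Z : Set (ComplexTorus Φ)} (hZ : HasPureDim 𝓘(ℂ, E) Z d) :
    analyticCycleClass Φ ((finCongr hmn).trans e) hX hZ = analyticCycleClass Φ e hX' hZ := by
  subst hmn; rfl

omit [Fintype ι₁] [Fintype ι₂] [DecidableEq ι₁] [FiniteDimensional ℂ E₁] [MeasurableSpace E₁] [BorelSpace E₁]
  [InnerProductSpace ℂ E₂] [FiniteDimensional ℂ E₂] [MeasurableSpace E₂] [BorelSpace E₂] in
/-- The orientation sign does not see a re-reading `Fin m = Fin n` of the enumeration. [folklore] -/
private theorem orientationSign_finCongr_trans₈ {ι : Type*} [DecidableEq ι] {E : Type*} [NormedAddCommGroup E]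
    [NormedSpace ℂ E] (Φ : (ι → ℝ) ≃L[ℝ] E) {m n : ℕ} (hmn : m = n) (e : Fin n ≃ ι) :
    orientationSign Φ ((finCongr hmn).trans e) = orientationSign Φ e := by
  subst hmn; rfl

omit [Fintype ι₁] [Fintype ι₂] [DecidableEq ι₁] [DecidableEq ι₂] [FiniteDimensional ℂ E₁] [MeasurableSpace E₁]
  [BorelSpace E₁] [FiniteDimensional ℂ E₂] [MeasurableSpace E₂] [BorelSpace E₂] in
/-- Complex scalars pass through the pull-back of complex-valued forms. [folklore] -/
private theorem complex_smul_compContinuousLinearMap₈ {V V' : Type*} [NormedAddCommGroup V] [NormedSpace ℝ V]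
    [NormedAddCommGroup V'] [NormedSpace ℝ V'] {k : ℕ} (c : ℂ) (α : V [⋀^Fin k]→L[ℝ] ℂ) (f : V' →L[ℝ] V) :
    (c • α).compContinuousLinearMap f = c • α.compContinuousLinearMap f := by
  ext v
  simp [ContinuousAlternatingMap.compContinuousLinearMap_apply]

/-- **The restriction of the class of the transpose along `i₀' : X₂ → X₂ × X₁` is the restriction of the
class along `i₁ : X₂ → X₁ × X₂`**, with the orientation signs:
`sign(e₂) sign(e₂ ⊔ e₁) · i₀'^*[ᵗZ]_{e₂ ⊔ e₁} = sign(e₁) · i₁^*[Z]_{e₁ ⊔ e₂}` for `ᵗZ = swap⁻¹ Z ⊆ X₂ × X₁`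
(`[ᵗZ] = ± [Z] ∘ swap`, `analyticCycleClass_preimage_swap`; `swap ∘ i₀' = i₁`; the signs collect to
`sign(e₂) sign(e₂ ⊔ e₁)² sign(e₁ ⊔ e₂) = sign(e₁)`). [cite: Lange2023AbelianVarietiesComplex, §6.2.2 p. 304]
[cite: Fulton1998, §19.2 Prop. 19.2] -/
theorem smul_compContinuousLinearMap_inl_analyticCycleClass_preimage_swap {n₂ : ℕ} (e₂ : Fin n₂ ≃ ι₂) {d k : ℕ}
    (hk : 2 * d + k = n₁ + n₂) (hk' : 2 * d + k = n₂ + n₁) {Z : Set (ComplexTorus (prodPeriodL2 Φ₁ Φ₂))}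
    (hZ : HasPureDim 𝓘(ℂ, WithLp 2 (E₁ × E₂)) Z d) :
    ((orientationSign Φ₂ e₂ * orientationSign (prodPeriod Φ₂ Φ₁) (sumEnum e₂ e₁) : ℤ) : ℂ) •
        (analyticCycleClass (prodPeriodL2 Φ₂ Φ₁) (sumEnum e₂ e₁) hk'
            ((isIsogeny_swap Φ₂ Φ₁).hasPureDim_preimage (prodPeriodL2 Φ₂ Φ₁) (prodPeriodL2 Φ₁ Φ₂) hZ)).compContinuousLinearMap
          (realRep Φ₂ (prodPeriodL2 Φ₂ Φ₁) (inlMatrix ι₂ ι₁)) =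
      (orientationSign Φ₁ e₁ : ℂ) •
        (analyticCycleClass (prodPeriodL2 Φ₁ Φ₂) (sumEnum e₁ e₂) hk hZ).compContinuousLinearMap
          (realRep Φ₂ (prodPeriodL2 Φ₁ Φ₂) (inrMatrix ι₁ ι₂)) := by
  -- `[ᵗZ]_{e₂ ⊔ e₁} = ± [Z]_{e₁ ⊔ e₂} ∘ swap`
  have hT := analyticCycleClass_preimage_swap Φ₁ Φ₂ (e := sumEnum e₂ e₁)
    (e' := (finCongr (Nat.add_comm n₂ n₁)).trans (sumEnum e₁ e₂)) (isIsogeny_swap Φ₂ Φ₁) hZ hk'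
  rw [analyticCycleClass_finCongr_trans₈ (prodPeriodL2 Φ₁ Φ₂) (Nat.add_comm n₂ n₁) (sumEnum e₁ e₂) hk' hk hZ,
    orientationSign_finCongr_trans₈ (prodPeriodL2 Φ₁ Φ₂) (Nat.add_comm n₂ n₁) (sumEnum e₁ e₂)] at hT
  -- signs
  have hsign : ((orientationSign Φ₂ e₂ * orientationSign (prodPeriod Φ₂ Φ₁) (sumEnum e₂ e₁) : ℤ) : ℂ) *
      ((orientationSign (prodPeriodL2 Φ₂ Φ₁) (sumEnum e₂ e₁) *
        orientationSign (prodPeriodL2 Φ₁ Φ₂) (sumEnum e₁ e₂) : ℤ) : ℂ) = (orientationSign Φ₁ e₁ : ℂ) := by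
    rw [orientationSign_sumEnum_eq_mul Φ₂ Φ₁ e₂ e₁, orientationSign_prodPeriodL2_sumEnum Φ₂ Φ₁ e₂ e₁,
      orientationSign_prodPeriodL2_sumEnum Φ₁ Φ₂ e₁ e₂]
    rcases orientationSign_eq_or Φ₁ e₁ with h1 | h1 <;> rcases orientationSign_eq_or Φ₂ e₂ with h2 | h2 <;>
      simp only [h1, h2] <;> norm_num
  -- `swap ∘ i₀' = i₁`
  have hcomp : ((analyticCycleClass (prodPeriodL2 Φ₁ Φ₂) (sumEnum e₁ e₂) hk hZ).compContinuousLinearMap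
      (((WithLp.prodContinuousLinearEquiv 2 ℝ E₁ E₂).symm : E₁ × E₂ →L[ℝ] WithLp 2 (E₁ × E₂)).comp
        ((ContinuousLinearEquiv.prodComm ℝ E₂ E₁ : E₂ × E₁ →L[ℝ] E₁ × E₂).comp
          (WithLp.prodContinuousLinearEquiv 2 ℝ E₂ E₁ : WithLp 2 (E₂ × E₁) →L[ℝ] E₂ × E₁)))).compContinuousLinearMap
      (realRep Φ₂ (prodPeriodL2 Φ₂ Φ₁) (inlMatrix ι₂ ι₁)) =
      (analyticCycleClass (prodPeriodL2 Φ₁ Φ₂) (sumEnum e₁ e₂) hk hZ).compContinuousLinearMap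
        (realRep Φ₂ (prodPeriodL2 Φ₁ Φ₂) (inrMatrix ι₁ ι₂)) := by
    ext v
    simp only [ContinuousAlternatingMap.compContinuousLinearMap_apply, Function.comp_def,
      ContinuousLinearMap.coe_comp, realRep_inlMatrix_prodPeriodL2_apply, realRep_inrMatrix_prodPeriodL2_apply]
    rfl
  rw [hT, complex_smul_compContinuousLinearMap₈, smul_smul, hsign, hcomp]

open Classical in
/-- **Specialization over the FIRST factor: every slice `Zˢ = {y | (s, y) ∈ Z}` carries an effective cycle
with class `sign(e₁) · i₁^*[Z]_{e₁ ⊔ e₂}`** (`Z ⊆ X₁ × X₂` closed analytic of pure dimension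
`q + 1 + dim X₁`, `0 < dim X₁`; §2 for the transpose `ᵗZ ⊆ X₂ × X₁` and the transposition identity).
[cite: Fulton1998, §10.1 Cor. 10.1, §10.2 Prop. 10.2 and §11.1] [cite: Chirka1989, §16.1 Prop. 1]
[cite: Lange2023AbelianVarietiesComplex, §6.2.2 p. 304] -/
theorem exists_effectiveCycle_fstSlice_eq_inr_pullback (hE₁ : 0 < finrank ℂ E₁) {n₂ : ℕ} (e₂ : Fin n₂ ≃ ι₂)
    (h₂ : 2 * (q + 1) + 2 * p = n₂) (hk : 2 * (q + 1 + finrank ℂ E₁) + 2 * p = n₁ + n₂)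
    {Z : Set (ComplexTorus (prodPeriodL2 Φ₁ Φ₂))}
    (hZ : HasPureDim 𝓘(ℂ, WithLp 2 (E₁ × E₂)) Z (q + 1 + finrank ℂ E₁)) (s₀ : ComplexTorus Φ₁) :
    ∃ S : HolomorphicChain 𝓘(ℂ, E₂) (ComplexTorus Φ₂) (q + 1), (∀ W, 0 ≤ S.mult W) ∧
      S.support ⊆ {y : ComplexTorus Φ₂ | (prodHomeomorphL2 Φ₁ Φ₂).symm (s₀, y) ∈ Z} ∧
        chainCycleClass Φ₂ e₂ h₂ S =
          (orientationSign Φ₁ e₁ : ℂ) •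
            (analyticCycleClass (prodPeriodL2 Φ₁ Φ₂) (sumEnum e₁ e₂) hk hZ).compContinuousLinearMap
              (realRep Φ₂ (prodPeriodL2 Φ₁ Φ₂) (inrMatrix ι₁ ι₂)) := by
  have hZt : HasPureDim 𝓘(ℂ, WithLp 2 (E₂ × E₁))
      (mapMatrix (prodPeriodL2 Φ₂ Φ₁) (prodPeriodL2 Φ₁ Φ₂)
        (Matrix.fromBlocks (0 : Matrix ι₁ ι₂ ℤ) (1 : Matrix ι₁ ι₁ ℤ) (1 : Matrix ι₂ ι₂ ℤ) (0 : Matrix ι₂ ι₁ ℤ)) ⁻¹' Z)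
      (q + 1 + finrank ℂ E₁) :=
    (isIsogeny_swap Φ₂ Φ₁).hasPureDim_preimage (prodPeriodL2 Φ₂ Φ₁) (prodPeriodL2 Φ₁ Φ₂) hZ
  have hk' : 2 * (q + 1 + finrank ℂ E₁) + 2 * p = n₂ + n₁ := by omega
  obtain ⟨S, hS0, hsupp, hcl⟩ :=
    exists_effectiveCycle_fibreSlice_eq_inl_pullback Φ₂ Φ₁ e₂ hE₁ (sumEnum e₂ e₁) h₂ hk' hZt s₀
  rw [fibreSlice_preimage_swap_eq] at hsupp
  exact ⟨S, hS0, hsupp, by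
    rw [hcl, smul_compContinuousLinearMap_inl_analyticCycleClass_preimage_swap Φ₁ Φ₂ e₁ e₂ hk hk' hZ]⟩

/-- The pull-back of `0` along a continuous linear map is `0`. [folklore] -/
private theorem zero_compContinuousLinearMap₈ {V V' : Type*} [NormedAddCommGroup V] [NormedSpace ℝ V]
    [NormedAddCommGroup V'] [NormedSpace ℝ V'] {k : ℕ} (f : V' →L[ℝ] V) :
    (0 : V [⋀^Fin k]→L[ℝ] ℂ).compContinuousLinearMap f = 0 :=
  ContinuousAlternatingMap.ext fun _ ↦ rfl

/-- A class of the form `c • β` with `c c = 1` vanishes iff `β` does. [folklore] -/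
private theorem smul_eq_zero_iff_of_mul_self₈ {V : Type*} [NormedAddCommGroup V] [NormedSpace ℝ V] {k : ℕ}
    {c : ℂ} (hc : c * c = 1) (β : V [⋀^Fin k]→L[ℝ] ℂ) : c • β = 0 ↔ β = 0 := by
  constructor
  · intro h
    have h' := congrArg (c • ·) h
    simp only [smul_smul, hc, one_smul] at h'
    rw [smul_zero] at h'
    exact h'
  · rintro rfl
    rw [smul_zero]

open Classical in
/-- **One empty slice over the first factor kills `i₁^*[Z]`**: if some `Zˢ⁰ = {y | (s₀, y) ∈ Z}` is empty
then `i₁^*[Z] = 0`. [cite: Fulton1998, §10.2 Prop. 10.2 and §11.1] [cite: Chirka1989, §16.1 Prop. 1] -/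
theorem compContinuousLinearMap_inr_analyticCycleClass_eq_zero_of_fstSlice_eq_empty (hE₁ : 0 < finrank ℂ E₁)
    {n₂ : ℕ} (e₂ : Fin n₂ ≃ ι₂) (hk : 2 * (q + 1 + finrank ℂ E₁) + 2 * p = n₁ + n₂)
    {Z : Set (ComplexTorus (prodPeriodL2 Φ₁ Φ₂))}
    (hZ : HasPureDim 𝓘(ℂ, WithLp 2 (E₁ × E₂)) Z (q + 1 + finrank ℂ E₁)) {s₀ : ComplexTorus Φ₁}
    (h0 : {y : ComplexTorus Φ₂ | (prodHomeomorphL2 Φ₁ Φ₂).symm (s₀, y) ∈ Z} = ∅) :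
    (analyticCycleClass (prodPeriodL2 Φ₁ Φ₂) (sumEnum e₁ e₂) hk hZ).compContinuousLinearMap
      (realRep Φ₂ (prodPeriodL2 Φ₁ Φ₂) (inrMatrix ι₁ ι₂)) = 0 := by
  have hng₂ : finrank ℂ E₂ * 2 = n₂ := finrank_complex_mul_two Φ₂ e₂
  have hng₁ : finrank ℂ E₁ * 2 = n₁ := finrank_complex_mul_two Φ₁ e₁
  have h₂ : 2 * (q + 1) + 2 * p = n₂ := by omega
  obtain ⟨S, hS0, hsupp, hcl⟩ := exists_effectiveCycle_fstSlice_eq_inr_pullback Φ₁ Φ₂ e₁ hE₁ e₂ h₂ hk hZ s₀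
  rw [h0, subset_empty_iff] at hsupp
  have hS : S.components ⊆ (∅ : Finset (Set (ComplexTorus Φ₂))) := by
    intro W hW
    obtain ⟨z, hz⟩ := (S.isIrreducibleAnalyticSet_and_hasPureDim hW).2.nonempty
    have : z ∈ S.support := HolomorphicChain.subset_support (HolomorphicChain.mem_components_iff.1 hW) hz
    rw [hsupp] at this
    exact this.elim
  rw [chainCycleClass_eq_sum_of_subset Φ₂ e₂ h₂ S hS, Finset.sum_empty] at hcl
  have hss : (orientationSign Φ₁ e₁ : ℂ) * orientationSign Φ₁ e₁ = 1 := by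
    exact_mod_cast orientationSign_mul_self Φ₁ e₁
  exact (smul_eq_zero_iff_of_mul_self₈ hss _).1 hcl.symm

open Classical in
/-- **`i₁^*[Z] ≠ 0 ⟹ pr₁(Z) = X₁`**, indeed every slice `Zˢ` contains an irreducible closed analytic
subset of dimension `q + 1`. [cite: Fulton1998, §10.1 Cor. 10.1 and §10.2 Prop. 10.2] -/
theorem exists_irreducible_subset_fstSlice_of_ne_zero (hE₁ : 0 < finrank ℂ E₁) {n₂ : ℕ} (e₂ : Fin n₂ ≃ ι₂)
    (hk : 2 * (q + 1 + finrank ℂ E₁) + 2 * p = n₁ + n₂) {Z : Set (ComplexTorus (prodPeriodL2 Φ₁ Φ₂))}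
    (hZ : HasPureDim 𝓘(ℂ, WithLp 2 (E₁ × E₂)) Z (q + 1 + finrank ℂ E₁))
    (hne : (analyticCycleClass (prodPeriodL2 Φ₁ Φ₂) (sumEnum e₁ e₂) hk hZ).compContinuousLinearMap
      (realRep Φ₂ (prodPeriodL2 Φ₁ Φ₂) (inrMatrix ι₁ ι₂)) ≠ 0) (s₀ : ComplexTorus Φ₁) :
    ∃ W ⊆ {y : ComplexTorus Φ₂ | (prodHomeomorphL2 Φ₁ Φ₂).symm (s₀, y) ∈ Z},
      IsIrreducibleAnalyticSet 𝓘(ℂ, E₂) W ∧ HasPureDim 𝓘(ℂ, E₂) W (q + 1) := by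
  have hng₂ : finrank ℂ E₂ * 2 = n₂ := finrank_complex_mul_two Φ₂ e₂
  have hng₁ : finrank ℂ E₁ * 2 = n₁ := finrank_complex_mul_two Φ₁ e₁
  have h₂ : 2 * (q + 1) + 2 * p = n₂ := by omega
  obtain ⟨S, hS0, hsupp, hcl⟩ := exists_effectiveCycle_fstSlice_eq_inr_pullback Φ₁ Φ₂ e₁ hE₁ e₂ h₂ hk hZ s₀
  by_cases hS : S.components = ∅
  · exfalso
    apply hne
    have hsub : S.components ⊆ (∅ : Finset (Set (ComplexTorus Φ₂))) := by rw [hS]; simp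
    rw [chainCycleClass_eq_sum_of_subset Φ₂ e₂ h₂ S hsub, Finset.sum_empty] at hcl
    have hss : (orientationSign Φ₁ e₁ : ℂ) * orientationSign Φ₁ e₁ = 1 := by
      exact_mod_cast orientationSign_mul_self Φ₁ e₁
    exact (smul_eq_zero_iff_of_mul_self₈ hss _).1 hcl.symm
  · obtain ⟨W, hW⟩ := Set.nonempty_iff_ne_empty.2 hS
    exact ⟨W, (HolomorphicChain.subset_support (HolomorphicChain.mem_components_iff.1 hW)).trans hsupp,
      S.isIrreducibleAnalyticSet_and_hasPureDim hW⟩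

/-! ### §4 The extreme Künneth components: `K_0[Z] ≠ 0 ⟹ pr₂(Z) = X₂`, `K_{2p}[Z] ≠ 0 ⟹ pr₁(Z) = X₁` -/

omit [DecidableEq ι₂] [FiniteDimensional ℂ E₁] [MeasurableSpace E₁] [BorelSpace E₁] [FiniteDimensional ℂ E₂]
  [MeasurableSpace E₂] [BorelSpace E₂] in
/-- **`i₀^* K_0 β = i₀^* β`**: restricting the Künneth component of type `(k, 0)` along `i₀ : x ↦ (x, 0)` gives
back the restriction of `β` (`K_0 = pr₁^* i₀^*` and `pr₁ ∘ i₀ = id`). [cite: Lange2023AbelianVarietiesComplex, §6.3.3 (6.14)]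
[cite: VoisinHodgeI2002, §11.3.3 Thm. 11.38] -/
theorem compContinuousLinearMap_inl_kunnethComponent_zero {k : ℕ} (β : WithLp 2 (E₁ × E₂) [⋀^Fin k]→L[ℝ] ℂ) :
    ((kunnethComponent 0 (β.compContinuousLinearMap
        ((WithLp.prodContinuousLinearEquiv 2 ℝ E₁ E₂).symm : E₁ × E₂ →L[ℝ] WithLp 2 (E₁ × E₂)))).compContinuousLinearMap
      (WithLp.prodContinuousLinearEquiv 2 ℝ E₁ E₂ : WithLp 2 (E₁ × E₂) →L[ℝ] E₁ × E₂)).compContinuousLinearMap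
        (realRep Φ₁ (prodPeriodL2 Φ₁ Φ₂) (inlMatrix ι₁ ι₂)) =
      β.compContinuousLinearMap (realRep Φ₁ (prodPeriodL2 Φ₁ Φ₂) (inlMatrix ι₁ ι₂)) := by
  rw [kunnethComponent_zero_compContinuousLinearMap_eq Φ₁ Φ₂]
  ext v
  simp only [ContinuousAlternatingMap.compContinuousLinearMap_apply, Function.comp_def,
    ContinuousLinearMap.coe_comp, realRep_inlMatrix_prodPeriodL2_apply]
  rfl

omit [DecidableEq ι₁] [FiniteDimensional ℂ E₁] [MeasurableSpace E₁] [BorelSpace E₁] [FiniteDimensional ℂ E₂]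
  [MeasurableSpace E₂] [BorelSpace E₂] in
/-- **`i₁^* K_k β = i₁^* β`** (`K_k = pr₂^* i₁^*`, `pr₂ ∘ i₁ = id`). [cite: Lange2023AbelianVarietiesComplex, §6.3.3 (6.14)]
[cite: VoisinHodgeI2002, §11.3.3 Thm. 11.38] -/
theorem compContinuousLinearMap_inr_kunnethComponent_self {k : ℕ} (β : WithLp 2 (E₁ × E₂) [⋀^Fin k]→L[ℝ] ℂ) :
    ((kunnethComponent k (β.compContinuousLinearMap
        ((WithLp.prodContinuousLinearEquiv 2 ℝ E₁ E₂).symm : E₁ × E₂ →L[ℝ] WithLp 2 (E₁ × E₂)))).compContinuousLinearMap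
      (WithLp.prodContinuousLinearEquiv 2 ℝ E₁ E₂ : WithLp 2 (E₁ × E₂) →L[ℝ] E₁ × E₂)).compContinuousLinearMap
        (realRep Φ₂ (prodPeriodL2 Φ₁ Φ₂) (inrMatrix ι₁ ι₂)) =
      β.compContinuousLinearMap (realRep Φ₂ (prodPeriodL2 Φ₁ Φ₂) (inrMatrix ι₁ ι₂)) := by
  rw [kunnethComponent_self_compContinuousLinearMap_eq Φ₁ Φ₂]
  ext v
  simp only [ContinuousAlternatingMap.compContinuousLinearMap_apply, Function.comp_def,
    ContinuousLinearMap.coe_comp, realRep_inrMatrix_prodPeriodL2_apply]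
  rfl

omit [DecidableEq ι₂] [FiniteDimensional ℂ E₁] [MeasurableSpace E₁] [BorelSpace E₁] [FiniteDimensional ℂ E₂]
  [MeasurableSpace E₂] [BorelSpace E₂] in
/-- **`K_0 β = 0 ⟺ i₀^* β = 0`** (`K_0 = pr₁^* i₀^*`, `pr₁^*` injective). [cite: Lange2023AbelianVarietiesComplex, §6.3.3 (6.14)]
[cite: VoisinHodgeI2002, §11.3.3 Thm. 11.38] -/
theorem kunnethComponent_zero_compContinuousLinearMap_eq_zero_iff {k : ℕ}
    (β : WithLp 2 (E₁ × E₂) [⋀^Fin k]→L[ℝ] ℂ) :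
    (kunnethComponent 0 (β.compContinuousLinearMap
        ((WithLp.prodContinuousLinearEquiv 2 ℝ E₁ E₂).symm : E₁ × E₂ →L[ℝ] WithLp 2 (E₁ × E₂)))).compContinuousLinearMap
      (WithLp.prodContinuousLinearEquiv 2 ℝ E₁ E₂ : WithLp 2 (E₁ × E₂) →L[ℝ] E₁ × E₂) = 0 ↔
      β.compContinuousLinearMap (realRep Φ₁ (prodPeriodL2 Φ₁ Φ₂) (inlMatrix ι₁ ι₂)) = 0 := by
  constructor
  · intro h
    rw [← compContinuousLinearMap_inl_kunnethComponent_zero Φ₁ Φ₂ β, h, zero_compContinuousLinearMap₈]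
  · intro h
    rw [kunnethComponent_zero_compContinuousLinearMap_eq Φ₁ Φ₂, h, zero_compContinuousLinearMap₈]

omit [DecidableEq ι₁] [FiniteDimensional ℂ E₁] [MeasurableSpace E₁] [BorelSpace E₁] [FiniteDimensional ℂ E₂]
  [MeasurableSpace E₂] [BorelSpace E₂] in
/-- **`K_k β = 0 ⟺ i₁^* β = 0`** (`K_k = pr₂^* i₁^*`, `pr₂^*` injective). [cite: Lange2023AbelianVarietiesComplex, §6.3.3 (6.14)]
[cite: VoisinHodgeI2002, §11.3.3 Thm. 11.38] -/
theorem kunnethComponent_self_compContinuousLinearMap_eq_zero_iff {k : ℕ}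
    (β : WithLp 2 (E₁ × E₂) [⋀^Fin k]→L[ℝ] ℂ) :
    (kunnethComponent k (β.compContinuousLinearMap
        ((WithLp.prodContinuousLinearEquiv 2 ℝ E₁ E₂).symm : E₁ × E₂ →L[ℝ] WithLp 2 (E₁ × E₂)))).compContinuousLinearMap
      (WithLp.prodContinuousLinearEquiv 2 ℝ E₁ E₂ : WithLp 2 (E₁ × E₂) →L[ℝ] E₁ × E₂) = 0 ↔
      β.compContinuousLinearMap (realRep Φ₂ (prodPeriodL2 Φ₁ Φ₂) (inrMatrix ι₁ ι₂)) = 0 := by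
  constructor
  · intro h
    rw [← compContinuousLinearMap_inr_kunnethComponent_self Φ₁ Φ₂ β, h, zero_compContinuousLinearMap₈]
  · intro h
    rw [kunnethComponent_self_compContinuousLinearMap_eq Φ₁ Φ₂, h, zero_compContinuousLinearMap₈]

open Classical in
/-- **`K_0[Z] ≠ 0 ⟹ pr₂(Z) = X₂`**: a non-zero Künneth component of type `(2p, 0)` of the class of a
closed analytic `Z ⊆ X₁ × X₂` of pure dimension `q + 1 + dim X₂` forces every fibre `Z_t` to contain an
irreducible analytic subset of dimension `q + 1`; equivalently ONE empty fibre gives `K_0[Z] = 0`.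
[cite: Fulton1998, §10.1 Cor. 10.1 and §10.2 Prop. 10.2] [cite: Lange2023AbelianVarietiesComplex, §6.3.3 Prop. 6.3.8] -/
theorem fibreSlice_nonempty_of_kunnethComponent_zero_ne_zero (hE₂ : 0 < finrank ℂ E₂) {n₂ : ℕ}
    (e₂ : Fin n₂ ≃ ι₂) (hk : 2 * (q + 1 + finrank ℂ E₂) + 2 * p = n₁ + n₂)
    {Z : Set (ComplexTorus (prodPeriodL2 Φ₁ Φ₂))}
    (hZ : HasPureDim 𝓘(ℂ, WithLp 2 (E₁ × E₂)) Z (q + 1 + finrank ℂ E₂))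
    (hne : (kunnethComponent 0 ((analyticCycleClass (prodPeriodL2 Φ₁ Φ₂) (sumEnum e₁ e₂) hk hZ).compContinuousLinearMap
        ((WithLp.prodContinuousLinearEquiv 2 ℝ E₁ E₂).symm : E₁ × E₂ →L[ℝ] WithLp 2 (E₁ × E₂)))).compContinuousLinearMap
      (WithLp.prodContinuousLinearEquiv 2 ℝ E₁ E₂ : WithLp 2 (E₁ × E₂) →L[ℝ] E₁ × E₂) ≠ 0)
    (t₀ : ComplexTorus Φ₂) :
    {x : ComplexTorus Φ₁ | (prodHomeomorphL2 Φ₁ Φ₂).symm (x, t₀) ∈ Z}.Nonempty := by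
  refine fibreSlice_nonempty_of_ne_zero Φ₁ Φ₂ hE₂ (sumEnum e₁ e₂) hk hZ (fun h ↦ hne ?_) t₀
  exact (kunnethComponent_zero_compContinuousLinearMap_eq_zero_iff Φ₁ Φ₂ _).2 h

open Classical in
/-- **`K_{2p}[Z] ≠ 0 ⟹ pr₁(Z) = X₁`**: a non-zero Künneth component of type `(0, 2p)` of the class of a
closed analytic `Z ⊆ X₁ × X₂` of pure dimension `q + 1 + dim X₁` forces every slice `Zˢ` over the first
factor to be non-empty. [cite: Fulton1998, §10.1 Cor. 10.1 and §10.2 Prop. 10.2]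
[cite: Lange2023AbelianVarietiesComplex, §6.3.3 Prop. 6.3.8] -/
theorem fstSlice_nonempty_of_kunnethComponent_self_ne_zero (hE₁ : 0 < finrank ℂ E₁) {n₂ : ℕ}
    (e₂ : Fin n₂ ≃ ι₂) (hk : 2 * (q + 1 + finrank ℂ E₁) + 2 * p = n₁ + n₂)
    {Z : Set (ComplexTorus (prodPeriodL2 Φ₁ Φ₂))}
    (hZ : HasPureDim 𝓘(ℂ, WithLp 2 (E₁ × E₂)) Z (q + 1 + finrank ℂ E₁))
    (hne : (kunnethComponent (2 * p) ((analyticCycleClass (prodPeriodL2 Φ₁ Φ₂) (sumEnum e₁ e₂) hk hZ).compContinuousLinearMap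
        ((WithLp.prodContinuousLinearEquiv 2 ℝ E₁ E₂).symm : E₁ × E₂ →L[ℝ] WithLp 2 (E₁ × E₂)))).compContinuousLinearMap
      (WithLp.prodContinuousLinearEquiv 2 ℝ E₁ E₂ : WithLp 2 (E₁ × E₂) →L[ℝ] E₁ × E₂) ≠ 0)
    (s₀ : ComplexTorus Φ₁) :
    {y : ComplexTorus Φ₂ | (prodHomeomorphL2 Φ₁ Φ₂).symm (s₀, y) ∈ Z}.Nonempty := by
  have hne' : (analyticCycleClass (prodPeriodL2 Φ₁ Φ₂) (sumEnum e₁ e₂) hk hZ).compContinuousLinearMap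
      (realRep Φ₂ (prodPeriodL2 Φ₁ Φ₂) (inrMatrix ι₁ ι₂)) ≠ 0 := fun h ↦
    hne ((kunnethComponent_self_compContinuousLinearMap_eq_zero_iff Φ₁ Φ₂ _).2 h)
  obtain ⟨W, hW, -, hWd⟩ := exists_irreducible_subset_fstSlice_of_ne_zero Φ₁ Φ₂ e₁ hE₁ e₂ hk hZ hne' s₀
  exact hWd.nonempty.mono hW

end Fibre


/-! ### §5 The special fibre of the expected dimension carries the whole limit cycle -/

section SpecialFibre

variable {ι₁ ι₂ : Type*} [Fintype ι₁] [Fintype ι₂] [DecidableEq ι₁] [DecidableEq ι₂]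
  {E₁ : Type u} [NormedAddCommGroup E₁] [InnerProductSpace ℂ E₁] [FiniteDimensional ℂ E₁]
  [MeasurableSpace E₁] [BorelSpace E₁]
  {E₂ : Type u} [NormedAddCommGroup E₂] [InnerProductSpace ℂ E₂] [FiniteDimensional ℂ E₂]
  [MeasurableSpace E₂] [BorelSpace E₂]
  (Φ₁ : (ι₁ → ℝ) ≃L[ℝ] E₁) (Φ₂ : (ι₂ → ℝ) ≃L[ℝ] E₂) {n₁ : ℕ} (e₁ : Fin n₁ ≃ ι₁) {p q : ℕ}

omit [DecidableEq ι₁] [DecidableEq ι₂] [MeasurableSpace E₁] [BorelSpace E₁] [MeasurableSpace E₂] [BorelSpace E₂] in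
/-- **`U ∩ Z_t ≠ ∅` for all `t` near `t₀`, at a point `x₀` of the fibre `Z_{t₀}` where the fibre has the
expected dimension.** Let `Z ⊆ X₁ × X₂` be closed analytic of pure dimension `r + dim X₂`, `(x₀, t₀) ∈ Z`,
and suppose the fibre `Z_{t₀} = {x | (x, t₀) ∈ Z}` has dimension `≤ r` at `x₀` (all its regular points near
`x₀` have codimension `≥ dim X₁ − r`). Then for every neighbourhood `U` of `x₀`: `U ∩ Z_t ≠ ∅` for all `t`
near `t₀`. REMMERT'S OPEN MAPPING THEOREM ([Fischer1976, §3.9 Prop.]) for the projection `pr₂ : Z → X₂`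
at `(x₀, t₀)` (fibre dimension `r = dim Z − dim X₂`): `pr₂(Z ∩ (U × X₂))` is a neighbourhood of `t₀`;
proved on the universal cover by `SCV.image_inter_mem_nhds_of_section` for `(x, y) ↦ y` on
`π⁻¹Z ⊆ E₁ ⊞ E₂` with the section `w ↦ (w, 0)`, and the open map `π₂`. Fulton, §10.2 / §11.1: the
points of the special fibre at which it has the expected dimension are limits of points of the nearby
fibres. [cite: Fischer1976, §3.9 Prop. and Cor. 2] [cite: Fulton1998, §10.2 Prop. 10.2 and §11.1]
[cite: Chirka1989, §3.8, p. 43] -/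
theorem eventually_nonempty_inter_fibreSlice {r : ℕ} {Z : Set (ComplexTorus (prodPeriodL2 Φ₁ Φ₂))}
    (hZ : HasPureDim 𝓘(ℂ, WithLp 2 (E₁ × E₂)) Z (r + finrank ℂ E₂)) {x₀ : ComplexTorus Φ₁}
    {t₀ : ComplexTorus Φ₂} (hx₀ : (prodHomeomorphL2 Φ₁ Φ₂).symm (x₀, t₀) ∈ Z)
    (hdim : ∀ᶠ x in 𝓝 x₀, (prodHomeomorphL2 Φ₁ Φ₂).symm (x, t₀) ∈ Z → ∀ c,
      IsRegularPointOfCodim 𝓘(ℂ, E₁) {x : ComplexTorus Φ₁ | (prodHomeomorphL2 Φ₁ Φ₂).symm (x, t₀) ∈ Z} c x →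
        finrank ℂ E₁ ≤ c + r)
    {U : Set (ComplexTorus Φ₁)} (hU : U ∈ 𝓝 x₀) :
    ∀ᶠ t in 𝓝 t₀, (U ∩ {x : ComplexTorus Φ₁ | (prodHomeomorphL2 Φ₁ Φ₂).symm (x, t) ∈ Z}).Nonempty := by
  classical
  -- lift to the universal covers
  obtain ⟨a, rfl⟩ := cover_surjective Φ₁ x₀
  obtain ⟨b, rfl⟩ := cover_surjective Φ₂ t₀
  set A : Set (WithLp 2 (E₁ × E₂)) := cover (prodPeriodL2 Φ₁ Φ₂) ⁻¹' Z with hAdef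
  have hA : ∀ x ∈ (univ : Set (WithLp 2 (E₁ × E₂))), Analysis.Complex.SCV.IsZeroSetAt A x := fun x _ =>
    isZeroSetAt_cover_preimage (prodPeriodL2 Φ₁ Φ₂) hZ.isAnalyticSet x
  have hpure : ∀ x ∈ SCV.regLocus A, SCV.IsRegPt A (finrank ℂ (WithLp 2 (E₁ × E₂)) - (r + finrank ℂ E₂)) x :=
    isRegPt_cover_preimage_of_hasPureDim (prodPeriodL2 Φ₁ Φ₂) hZ
  have hm : r + finrank ℂ E₂ ≤ finrank ℂ (WithLp 2 (E₁ × E₂)) := hZ.le_finrank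
  -- `π z = prodHomeomorphL2⁻¹ (π₁ z.1, π₂ z.2)`
  have hcov : ∀ z : WithLp 2 (E₁ × E₂),
      cover (prodPeriodL2 Φ₁ Φ₂) z = (prodHomeomorphL2 Φ₁ Φ₂).symm (cover Φ₁ (ofLp z).1, cover Φ₂ (ofLp z).2) :=
    fun z => (prodHomeomorphL2 Φ₁ Φ₂).injective (by rw [Homeomorph.apply_symm_apply, prodHomeomorphL2_cover])
  have haA : toLp 2 (a, b) ∈ A := by
    show cover (prodPeriodL2 Φ₁ Φ₂) (toLp 2 (a, b)) ∈ Z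
    rw [hcov]
    simpa only [WithLp.ofLp_toLp] using hx₀
  -- the projection to `E₂` and the section `w ↦ (w, 0)`
  set ℓ : WithLp 2 (E₁ × E₂) →L[ℂ] E₂ := (ContinuousLinearMap.snd ℂ E₁ E₂).comp
    (WithLp.prodContinuousLinearEquiv 2 ℂ E₁ E₂ : WithLp 2 (E₁ × E₂) →L[ℂ] E₁ × E₂) with hℓdef
  have hℓapply : ∀ z, ℓ z = (ofLp z).2 := fun z => rfl
  have hℓ : Function.Surjective ℓ := fun v => ⟨toLp 2 (0, v), rfl⟩
  set κ : E₁ →L[ℂ] WithLp 2 (E₁ × E₂) :=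
    ((WithLp.prodContinuousLinearEquiv 2 ℂ E₁ E₂).symm : E₁ × E₂ →L[ℂ] WithLp 2 (E₁ × E₂)).comp
      (ContinuousLinearMap.inl ℂ E₁ E₂) with hκdef
  have hκapply : ∀ w, κ w = toLp 2 (w, 0) := fun w => rfl
  have hκ : Function.Injective κ := fun v w h => by
    have := congrArg (fun z => (ofLp z).1) h
    simpa [hκapply] using this
  have hκℓ : ∀ w, ℓ (κ w) = 0 := fun w => rfl
  have hrank : finrank ℂ E₁ + finrank ℂ E₂ = finrank ℂ (WithLp 2 (E₁ × E₂)) := by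
    rw [(WithLp.prodContinuousLinearEquiv 2 ℂ E₁ E₂).toLinearEquiv.finrank_eq, Module.finrank_prod]
  -- the section `{w | toLp (a, b) + κ w ∈ A}` is the translate by `a` of `π₁⁻¹(Z_{t₀})`
  have hsecset : {w : E₁ | toLp 2 (a, b) + κ w ∈ A} =
      {v : E₁ | a + v ∈ cover Φ₁ ⁻¹' {x : ComplexTorus Φ₁ | (prodHomeomorphL2 Φ₁ Φ₂).symm (x, cover Φ₂ b) ∈ Z}} := by
    ext v
    simp only [mem_setOf_eq, mem_preimage, hκapply, hAdef]
    rw [← WithLp.toLp_add, Prod.mk_add_mk, add_zero, hcov, WithLp.ofLp_toLp]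
  have hcont : Continuous fun v : E₁ => cover Φ₁ (a + v) :=
    (continuous_cover Φ₁).comp (continuous_const.add continuous_id)
  have htend : Tendsto (fun v : E₁ => cover Φ₁ (a + v)) (𝓝 0) (𝓝 (cover Φ₁ a)) := by
    have := hcont.tendsto 0
    rwa [add_zero] at this
  have hsec : ∀ᶠ w in 𝓝 (0 : E₁), toLp 2 (a, b) + κ w ∈ A → ∀ c,
      SCV.IsRegPt {w : E₁ | toLp 2 (a, b) + κ w ∈ A} c w → finrank ℂ E₁ ≤ c + r := by
    rw [hsecset]
    filter_upwards [htend.eventually hdim] with v hv hvA c hc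
    have hvA' : (prodHomeomorphL2 Φ₁ Φ₂).symm (cover Φ₁ (a + v), cover Φ₂ b) ∈ Z := by
      have h' : v ∈ {w : E₁ | toLp 2 (a, b) + κ w ∈ A} := hvA
      rw [hsecset] at h'
      exact h'
    refine hv hvA' c ?_
    have h1 := SCV.isRegPt_preimage_add_iff.1 hc
    exact (isRegularPointOfCodim_cover_preimage_iff Φ₁ (a + v)).1 (SCV.isRegularPointOfCodim_iff_isRegPt.2 h1)
  -- Remmert for `ℓ` on `A` at `toLp (a, b)` with the neighbourhood `{z | π₁ (z.1) ∈ U}`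
  have hU' : {z : WithLp 2 (E₁ × E₂) | (ofLp z).1 ∈ cover Φ₁ ⁻¹' U} ∈ 𝓝 (toLp 2 (a, b)) := by
    have hc : Continuous fun z : WithLp 2 (E₁ × E₂) => cover Φ₁ (ofLp z).1 :=
      (continuous_cover Φ₁).comp ((continuous_fst).comp (WithLp.prodContinuousLinearEquiv 2 ℂ E₁ E₂).continuous)
    exact hc.continuousAt.preimage_mem_nhds (by exact hU)
  have hmain := SCV.image_inter_mem_nhds_of_section hℓ κ hκ hκℓ hrank isOpen_univ (subset_univ A) hA haA hm
    hpure rfl hsec hU'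
  -- push down by the open map `π₂`
  have hopen : IsOpenMap (cover Φ₂) := (isOpenQuotientMap_cover (Φ := Φ₂)).isOpenMap
  have h2 := hopen.image_mem_nhds hmain
  filter_upwards [h2] with t ht
  obtain ⟨s, ⟨z, ⟨hzA, hzU⟩, rfl⟩, rfl⟩ := ht
  refine ⟨cover Φ₁ (ofLp z).1, hzU, ?_⟩
  show (prodHomeomorphL2 Φ₁ Φ₂).symm (cover Φ₁ (ofLp z).1, cover Φ₂ (ℓ z)) ∈ Z
  rw [hℓapply, ← hcov]
  exact hzA

omit [DecidableEq ι₁] [DecidableEq ι₂] [MeasurableSpace E₁] [BorelSpace E₁] [MeasurableSpace E₂] [BorelSpace E₂] in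
/-- **Limit-set form**: under the hypotheses of `eventually_nonempty_inter_fibreSlice`, for every sequence
`t_j → t₀` and every `N`, `x₀ ∈ closure (⋃_{j ≥ N} Z_{t_j})`. [cite: Fulton1998, §11.1]
[cite: Fischer1976, §3.9 Prop.] -/
theorem mem_closure_iUnion_fibreSlice {r : ℕ} {Z : Set (ComplexTorus (prodPeriodL2 Φ₁ Φ₂))}
    (hZ : HasPureDim 𝓘(ℂ, WithLp 2 (E₁ × E₂)) Z (r + finrank ℂ E₂)) {x₀ : ComplexTorus Φ₁}
    {t₀ : ComplexTorus Φ₂} (hx₀ : (prodHomeomorphL2 Φ₁ Φ₂).symm (x₀, t₀) ∈ Z)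
    (hdim : ∀ᶠ x in 𝓝 x₀, (prodHomeomorphL2 Φ₁ Φ₂).symm (x, t₀) ∈ Z → ∀ c,
      IsRegularPointOfCodim 𝓘(ℂ, E₁) {x : ComplexTorus Φ₁ | (prodHomeomorphL2 Φ₁ Φ₂).symm (x, t₀) ∈ Z} c x →
        finrank ℂ E₁ ≤ c + r)
    {t : ℕ → ComplexTorus Φ₂} (ht : Tendsto t atTop (𝓝 t₀)) (N : ℕ) :
    x₀ ∈ closure (⋃ j ≥ N, {x : ComplexTorus Φ₁ | (prodHomeomorphL2 Φ₁ Φ₂).symm (x, t j) ∈ Z}) := by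
  rw [mem_closure_iff_nhds]
  intro U hU
  have hev := ht.eventually (eventually_nonempty_inter_fibreSlice Φ₁ Φ₂ hZ hx₀ hdim hU)
  obtain ⟨j, hj, hjN⟩ := (hev.and (eventually_ge_atTop N)).exists
  obtain ⟨x, hxU, hx⟩ := hj
  refine ⟨x, hxU, ?_⟩
  simp only [mem_iUnion, mem_setOf_eq, exists_prop]
  exact ⟨j, hjN, hx⟩

omit [DecidableEq ι₁] [DecidableEq ι₂] [MeasurableSpace E₁] [BorelSpace E₁] [MeasurableSpace E₂] [BorelSpace E₂] in
/-- **Limit-set form for a special fibre of the expected PURE dimension**: every point of `Z_{t₀}` lies in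
`closure (⋃_{j ≥ N} Z_{t_j})` for `t_j → t₀`. [cite: Fulton1998, §11.1] [cite: Fischer1976, §3.9 Prop.] -/
theorem mem_closure_iUnion_fibreSlice_of_hasPureDim {r : ℕ} {Z : Set (ComplexTorus (prodPeriodL2 Φ₁ Φ₂))}
    (hZ : HasPureDim 𝓘(ℂ, WithLp 2 (E₁ × E₂)) Z (r + finrank ℂ E₂)) {t₀ : ComplexTorus Φ₂}
    (hF : HasPureDim 𝓘(ℂ, E₁) {x : ComplexTorus Φ₁ | (prodHomeomorphL2 Φ₁ Φ₂).symm (x, t₀) ∈ Z} r)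
    {x₀ : ComplexTorus Φ₁} (hx₀ : (prodHomeomorphL2 Φ₁ Φ₂).symm (x₀, t₀) ∈ Z)
    {t : ℕ → ComplexTorus Φ₂} (ht : Tendsto t atTop (𝓝 t₀)) (N : ℕ) :
    x₀ ∈ closure (⋃ j ≥ N, {x : ComplexTorus Φ₁ | (prodHomeomorphL2 Φ₁ Φ₂).symm (x, t j) ∈ Z}) := by
  refine mem_closure_iUnion_fibreSlice Φ₁ Φ₂ hZ hx₀ (Eventually.of_forall ?_) ht N
  intro x hx c hc
  obtain ⟨c', hc', -, -, hreg⟩ := hF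
  have hxF : x ∈ {x : ComplexTorus Φ₁ | (prodHomeomorphL2 Φ₁ Φ₂).symm (x, t₀) ∈ Z} := hx
  have h := IsRegularPointOfCodim.codim_unique hxF (hreg x ⟨hxF, c, hc⟩) hc
  omega

open Classical in
/-- **THE SPECIALIZED CYCLE OF A FIBRE OF THE EXPECTED PURE DIMENSION IS SUPPORTED ON THE WHOLE FIBRE.**
For `Z ⊆ X₁ × X₂` closed analytic of pure dimension `q + 1 + dim X₂` (`dim X₂ > 0`) and `t₀ ∈ X₂` such
that the fibre `Z_{t₀}` has the expected pure dimension `q + 1`, there is an effective holomorphic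
`(q+1)`-chain `S ≥ 0` of `X₁` with `|S| = Z_{t₀}` EXACTLY and `cl_{e₁}(S) = sign(e₁) sign(e) · i₀^*[Z]_e`.
As in §2, `S` is Bishop's limit of generic fibres `Z_{t_j}`, `t_j → t₀` (these are of pure dimension
`q + 1`: the a.e.-empty alternative is excluded because the fibres near `t₀` are non-empty by
`eventually_nonempty_inter_fibreSlice`), and every point of `Z_{t₀}` lies in the limit set
(`mem_closure_iUnion_fibreSlice_of_hasPureDim`). Fulton, §11.1: the limit cycle of a family at a
special fibre of the expected dimension is `Σ m_C [C]` over ALL its components, `m_C ≥ 1`.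
[cite: Fulton1998, §10.1 Cor. 10.1, §10.2 Prop. 10.2 and §11.1] [cite: Fischer1976, §3.9 Prop.]
[cite: Chirka1989, §16.1 Prop. 1] -/
theorem exists_effectiveCycle_fibreSlice_eq_inl_pullback_support_eq (hE₂ : 0 < finrank ℂ E₂) {n : ℕ}
    (e : Fin n ≃ ι₁ ⊕ ι₂) (h₁ : 2 * (q + 1) + 2 * p = n₁) (hk : 2 * (q + 1 + finrank ℂ E₂) + 2 * p = n)
    {Z : Set (ComplexTorus (prodPeriodL2 Φ₁ Φ₂))}
    (hZ : HasPureDim 𝓘(ℂ, WithLp 2 (E₁ × E₂)) Z (q + 1 + finrank ℂ E₂)) {t₀ : ComplexTorus Φ₂}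
    (hF : HasPureDim 𝓘(ℂ, E₁) {x : ComplexTorus Φ₁ | (prodHomeomorphL2 Φ₁ Φ₂).symm (x, t₀) ∈ Z} (q + 1)) :
    ∃ S : HolomorphicChain 𝓘(ℂ, E₁) (ComplexTorus Φ₁) (q + 1), (∀ W, 0 ≤ S.mult W) ∧
      S.support = {x : ComplexTorus Φ₁ | (prodHomeomorphL2 Φ₁ Φ₂).symm (x, t₀) ∈ Z} ∧
        chainCycleClass Φ₁ e₁ h₁ S =
          ((orientationSign Φ₁ e₁ * orientationSign (prodPeriod Φ₁ Φ₂) e : ℤ) : ℂ) •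
            (analyticCycleClass (prodPeriodL2 Φ₁ Φ₂) e hk hZ).compContinuousLinearMap
              (realRep Φ₁ (prodPeriodL2 Φ₁ Φ₂) (inlMatrix ι₁ ι₂)) := by
  -- the generic class `R`
  have hcl := ae_volume_setCycleClass_fibreSlice_eq_inl_pullback Φ₁ Φ₂ e₁ hE₂ e (Nat.succ_pos q) h₁ hk hZ
  -- fibres near `t₀` are non-empty (Remmert at a point of the special fibre)
  obtain ⟨x₀, hx₀⟩ := hF.nonempty
  have hne : ∀ᶠ t in 𝓝 t₀, {x : ComplexTorus Φ₁ | (prodHomeomorphL2 Φ₁ Φ₂).symm (x, t) ∈ Z}.Nonempty := by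
    have h := eventually_nonempty_inter_fibreSlice Φ₁ Φ₂ hZ hx₀ (Eventually.of_forall fun x hx c hc ↦ ?_) univ_mem
    · simpa only [univ_inter] using h
    · obtain ⟨c', hc', -, -, hreg⟩ := id hF
      have hxF : x ∈ {x : ComplexTorus Φ₁ | (prodHomeomorphL2 Φ₁ Φ₂).symm (x, t₀) ∈ Z} := hx
      have h := IsRegularPointOfCodim.codim_unique hxF (hreg x ⟨hxF, c, hc⟩) hc
      omega
  obtain ⟨N₀, hN₀, hN₀o, h0N₀⟩ := _root_.mem_nhds_iff.1 hne
  -- a.e. fibre is of pure dimension `q + 1` (the a.e.-empty alternative contradicts `hne` by density)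
  have hpure : ∀ᵐ t ∂(volume : Measure (ComplexTorus Φ₂)),
      HasPureDim 𝓘(ℂ, E₁) {x : ComplexTorus Φ₁ | (prodHomeomorphL2 Φ₁ Φ₂).symm (x, t) ∈ Z} (q + 1) := by
    rcases ae_volume_fibreSlice_eq_empty_or_ae_volume_hasPureDim Φ₁ Φ₂ e₁ (p := p) (Nat.succ_pos q) h₁ hZ
      with h | h
    · exfalso
      have hd := Measure.dense_of_ae h
      obtain ⟨t, htN, ht⟩ := hd.inter_open_nonempty N₀ hN₀o ⟨t₀, h0N₀⟩
      exact (hN₀ htN).ne_empty ht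
    · exact h
  -- a dense set of good parameters; a sequence of them tending to `t₀`
  have hdense := Measure.dense_of_ae (hpure.and hcl)
  obtain ⟨t, htG, ht0⟩ := mem_closure_iff_seq_limit.1 (hdense t₀)
  have hZt : ∀ j, HasPureDim 𝓘(ℂ, E₁)
      {x : ComplexTorus Φ₁ | (prodHomeomorphL2 Φ₁ Φ₂).symm (x, t j) ∈ Z} (q + 1) := fun j ↦ (htG j).1
  have hclass : ∀ j, analyticCycleClass Φ₁ e₁ h₁ (hZt j) =
      ((orientationSign Φ₁ e₁ * orientationSign (prodPeriod Φ₁ Φ₂) e : ℤ) : ℂ) •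
        (analyticCycleClass (prodPeriodL2 Φ₁ Φ₂) e hk hZ).compContinuousLinearMap
          (realRep Φ₁ (prodPeriodL2 Φ₁ Φ₂) (inlMatrix ι₁ ι₂)) := by
    intro j
    rw [← setCycleClass_of_hasPureDim Φ₁ e₁ h₁ (hZt j)]
    exact (htG j).2
  -- constant volume (Wirtinger)
  obtain ⟨V, hV⟩ : ∃ V : ℝ, ∀ j,
      (μHE[2 * (q + 1)] : Measure E₁).real (periodBox Φ₁ 0 ∩ (analyticChain Φ₁ (hZt j)).carrier) = V := by
    refine ⟨(poincarePairing Φ₁ e₁ h₁ (ofRealCLM.compContinuousAlternatingMap (kaehlerPow (q + 1)))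
      (((orientationSign Φ₁ e₁ * orientationSign (prodPeriod Φ₁ Φ₂) e : ℤ) : ℂ) •
        (analyticCycleClass (prodPeriodL2 Φ₁ Φ₂) e hk hZ).compContinuousLinearMap
          (realRep Φ₁ (prodPeriodL2 Φ₁ Φ₂) (inlMatrix ι₁ ι₂)))).re, fun j ↦ ?_⟩
    have h := poincarePairing_kaehlerPow_analyticCycleClass Φ₁ e₁ h₁ (hZt j)
    rw [hclass j] at h
    rw [h, Complex.ofReal_re]
  have hvol : ∀ j, (μHE[2 * (q + 1)] : Measure E₁)
      (cover Φ₁ ⁻¹' {x : ComplexTorus Φ₁ | (prodHomeomorphL2 Φ₁ Φ₂).symm (x, t j) ∈ Z} ∩ periodBox Φ₁ 0) ≤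
        ENNReal.ofReal V := by
    intro j
    have heq : (μHE[2 * (q + 1)] : Measure E₁)
        (cover Φ₁ ⁻¹' {x : ComplexTorus Φ₁ | (prodHomeomorphL2 Φ₁ Φ₂).symm (x, t j) ∈ Z} ∩ periodBox Φ₁ 0) =
        (μHE[2 * (q + 1)] : Measure E₁) (periodBox Φ₁ 0 ∩ (analyticChain Φ₁ (hZt j)).carrier) := by
      rw [← image_val_liftSet, analyticChain,
        HolomorphicChain.measure_image_inter_eq_carrier_inter (hasPureDim_liftSet Φ₁ (hZt j)), inter_comm]
    rw [heq, ← ENNReal.ofReal_toReal (measure_periodBox_inter_carrier_lt_top Φ₁ (hZt j) 0).ne, ← measureReal_def,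
      hV j]
  -- Bishop
  obtain ⟨κ, S, hκ, hS0, -, hsupp, hclS, -⟩ :=
    exists_subseq_effectiveCycle_of_measure_le Φ₁ hZt e₁ h₁ ENNReal.ofReal_lt_top hvol
  refine ⟨S, hS0, Subset.antisymm (fun z hz ↦ ?_) (fun z hz ↦ ?_), ?_⟩
  · -- the limit set lies in the special fibre (`Z` closed), as in §2
    have hC : IsClosed {w : ComplexTorus Φ₁ × ComplexTorus Φ₂ | (prodHomeomorphL2 Φ₁ Φ₂).symm w ∈ Z} :=
      hZ.isAnalyticSet.isClosed.preimage (prodHomeomorphL2 Φ₁ Φ₂).symm.continuous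
    exact mem_fibre_of_forall_mem_closure_iUnion_fibre hC (ht0.comp hκ.tendsto_atTop) ((hsupp z).1 hz)
  · -- every point of the special fibre is a limit point of the generic fibres (Remmert)
    exact (hsupp z).2 fun N ↦
      mem_closure_iUnion_fibreSlice_of_hasPureDim Φ₁ Φ₂ hZ hF hz (ht0.comp hκ.tendsto_atTop) N
  · obtain ⟨j, hj⟩ := hclS.exists
    rw [← hj, hclass]

open Classical in
/-- **A fibre of the expected pure dimension makes the restriction class non-zero: `i₀^*[Z]_e ≠ 0`** (the
specialized cycle on it is a non-zero effective cycle). [cite: Fulton1998, §10.2 Prop. 10.2 and §11.1]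
[cite: Chirka1989, §13.3 Cor. and §16.1 Prop. 1] -/
theorem compContinuousLinearMap_inl_analyticCycleClass_ne_zero_of_hasPureDim_fibreSlice (hE₂ : 0 < finrank ℂ E₂)
    {n : ℕ} (e : Fin n ≃ ι₁ ⊕ ι₂) (hk : 2 * (q + 1 + finrank ℂ E₂) + 2 * p = n)
    {Z : Set (ComplexTorus (prodPeriodL2 Φ₁ Φ₂))}
    (hZ : HasPureDim 𝓘(ℂ, WithLp 2 (E₁ × E₂)) Z (q + 1 + finrank ℂ E₂)) {t₀ : ComplexTorus Φ₂}
    (hF : HasPureDim 𝓘(ℂ, E₁) {x : ComplexTorus Φ₁ | (prodHomeomorphL2 Φ₁ Φ₂).symm (x, t₀) ∈ Z} (q + 1)) :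
    (analyticCycleClass (prodPeriodL2 Φ₁ Φ₂) e hk hZ).compContinuousLinearMap
      (realRep Φ₁ (prodPeriodL2 Φ₁ Φ₂) (inlMatrix ι₁ ι₂)) ≠ 0 := by
  -- an enumeration of the lattice basis of `X₁` in the right degree
  have hn : n = Fintype.card ι₁ + Fintype.card ι₂ := by
    rw [← Fintype.card_sum, ← Fintype.card_fin n]; exact Fintype.card_congr e
  have hng₂ : finrank ℂ E₂ * 2 = Fintype.card ι₂ := by
    rw [← Module.finrank_fintype_fun_eq_card (R := ℝ), Φ₂.toLinearEquiv.finrank_eq, finrank_real_of_complex, mul_comm]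
  have h₁ : 2 * (q + 1) + 2 * p = Fintype.card ι₁ := by omega
  set e₁' : Fin (Fintype.card ι₁) ≃ ι₁ := (Fintype.equivFin ι₁).symm with he₁'
  obtain ⟨S, hS0, hsupp, hcl⟩ :=
    exists_effectiveCycle_fibreSlice_eq_inl_pullback_support_eq Φ₁ Φ₂ e₁' hE₂ e h₁ hk hZ hF
  -- `S` has a component (its support, the fibre, is non-empty), of positive volume `≤ deg S`
  obtain ⟨z, hz⟩ := hF.nonempty
  rw [← hsupp] at hz
  obtain ⟨W, hW0, -⟩ := HolomorphicChain.mem_support_iff.1 hz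
  intro h0
  rw [h0, smul_zero] at hcl
  have hle := volume_le_degree_of_mem_components Φ₁ e₁' h₁ hS0 hW0
  rw [hcl, map_zero, Complex.zero_re, measureReal_def] at hle
  have hpos := ENNReal.toReal_pos (measure_periodBox_inter_carrier_pos Φ₁ (S.hasPureDim_of_mult_ne_zero hW0) 0).ne'
    (measure_periodBox_inter_carrier_lt_top Φ₁ (S.hasPureDim_of_mult_ne_zero hW0) 0).ne
  exact absurd hle (not_le.2 hpos)

open Classical in
/-- **`sign(e₁) sign(e) · i₀^*[Z]_e = Σ_C m_C cl_{e₁}(C)` over the irreducible components `C` of a fibre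
`Z_{t₀}` of the expected pure dimension, with ALL `m_C ≥ 1`** — every proper component of the special
fibre appears in the limit cycle with positive multiplicity (Fulton, §11.1; cf. Prop. 7.1 (a)).
[cite: Fulton1998, §11.1 and §7.1 Prop. 7.1 (a)] [cite: Chirka1989, §16.1 Prop. 1] -/
theorem exists_inl_pullback_eq_sum_isIrreducibleComponent_pos (hE₂ : 0 < finrank ℂ E₂) {n : ℕ}
    (e : Fin n ≃ ι₁ ⊕ ι₂) (h₁ : 2 * (q + 1) + 2 * p = n₁) (hk : 2 * (q + 1 + finrank ℂ E₂) + 2 * p = n)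
    {Z : Set (ComplexTorus (prodPeriodL2 Φ₁ Φ₂))}
    (hZ : HasPureDim 𝓘(ℂ, WithLp 2 (E₁ × E₂)) Z (q + 1 + finrank ℂ E₂)) {t₀ : ComplexTorus Φ₂}
    (hF : HasPureDim 𝓘(ℂ, E₁) {x : ComplexTorus Φ₁ | (prodHomeomorphL2 Φ₁ Φ₂).symm (x, t₀) ∈ Z} (q + 1)) :
    ∃ m : Set (ComplexTorus Φ₁) → ℤ,
      (∀ C, IsIrreducibleComponent 𝓘(ℂ, E₁) {x : ComplexTorus Φ₁ | (prodHomeomorphL2 Φ₁ Φ₂).symm (x, t₀) ∈ Z} C →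
        1 ≤ m C) ∧
      (∀ C, m C ≠ 0 →
        IsIrreducibleComponent 𝓘(ℂ, E₁) {x : ComplexTorus Φ₁ | (prodHomeomorphL2 Φ₁ Φ₂).symm (x, t₀) ∈ Z} C) ∧
      ((orientationSign Φ₁ e₁ * orientationSign (prodPeriod Φ₁ Φ₂) e : ℤ) : ℂ) •
          (analyticCycleClass (prodPeriodL2 Φ₁ Φ₂) e hk hZ).compContinuousLinearMap
            (realRep Φ₁ (prodPeriodL2 Φ₁ Φ₂) (inlMatrix ι₁ ι₂)) =
        ∑ C ∈ (finite_isIrreducibleComponent Φ₁ hF.isAnalyticSet).toFinset, m C • setCycleClass Φ₁ e₁ h₁ C := by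
  obtain ⟨S, hS0, hsupp, hcl⟩ :=
    exists_effectiveCycle_fibreSlice_eq_inl_pullback_support_eq Φ₁ Φ₂ e₁ hE₂ e h₁ hk hZ hF
  have hcomp : ∀ C, S.mult C ≠ 0 →
      IsIrreducibleComponent 𝓘(ℂ, E₁) {x : ComplexTorus Φ₁ | (prodHomeomorphL2 Φ₁ Φ₂).symm (x, t₀) ∈ Z} C :=
    fun C hC ↦ isIrreducibleComponent_of_subset_of_hasPureDim hF (S.isIrreducibleAnalyticSet_of_mult_ne_zero hC)
      (S.hasPureDim_of_mult_ne_zero hC) ((HolomorphicChain.subset_support hC).trans hsupp.le)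
  have hpos : ∀ C, IsIrreducibleComponent 𝓘(ℂ, E₁)
      {x : ComplexTorus Φ₁ | (prodHomeomorphL2 Φ₁ Φ₂).symm (x, t₀) ∈ Z} C → 1 ≤ S.mult C := by
    intro C hC
    have hCsub : C ⊆ ⋃ W ∈ S.finite_components_of_compactSpace.toFinset, W := by
      intro x hx
      have hx' : x ∈ S.support := by rw [hsupp]; exact hC.subset hx
      obtain ⟨W, hW0, hxW⟩ := HolomorphicChain.mem_support_iff.1 hx'
      exact mem_iUnion₂.2 ⟨W, S.finite_components_of_compactSpace.mem_toFinset.2 hW0, hxW⟩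
    obtain ⟨W, hW, hCW⟩ := hC.isIrreducibleAnalyticSet.exists_subset_of_subset_biUnion
      S.finite_components_of_compactSpace.toFinset
      (fun W hW ↦ (S.isIrreducibleAnalyticSet_of_mult_ne_zero
        (S.finite_components_of_compactSpace.mem_toFinset.1 hW)).1) hCsub
    have hW0 : S.mult W ≠ 0 := S.finite_components_of_compactSpace.mem_toFinset.1 hW
    have hWC : W = C := hC.eq_of_subset (S.isIrreducibleAnalyticSet_of_mult_ne_zero hW0) hCW
      ((HolomorphicChain.subset_support hW0).trans hsupp.le)
    rw [← hWC]
    have h0 := hS0 W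
    omega
  refine ⟨S.mult, hpos, hcomp, ?_⟩
  rw [← hcl, chainCycleClass_eq_sum_of_subset Φ₁ e₁ h₁ S]
  intro C hC
  exact (finite_isIrreducibleComponent Φ₁ hF.isAnalyticSet).mem_toFinset.2
    (hcomp C (HolomorphicChain.mem_components_iff.1 hC))

end SpecialFibre

/-! ### §6 Proper points of an arbitrary special fibre -/

section ProperFibrePoints

variable {ι₁ ι₂ : Type*} [Fintype ι₁] [Fintype ι₂] [DecidableEq ι₁] [DecidableEq ι₂]
  {E₁ : Type u} [NormedAddCommGroup E₁] [InnerProductSpace ℂ E₁] [FiniteDimensional ℂ E₁]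
  [MeasurableSpace E₁] [BorelSpace E₁]
  {E₂ : Type u} [NormedAddCommGroup E₂] [InnerProductSpace ℂ E₂] [FiniteDimensional ℂ E₂]
  [MeasurableSpace E₂] [BorelSpace E₂]
  (Φ₁ : (ι₁ → ℝ) ≃L[ℝ] E₁) (Φ₂ : (ι₂ → ℝ) ≃L[ℝ] E₂) {n₁ : ℕ} (e₁ : Fin n₁ ≃ ι₁) {p q : ℕ}

open Classical in
/-- **One fibre point of the expected dimension makes the restriction class non-zero: `i₀^*[Z]_e ≠ 0`.** If
`(x₀, t₀) ∈ Z` and the fibre `Z_{t₀}` has dimension `≤ q + 1` at `x₀`, then `i₀^*[Z] ≠ 0`: the fibres `Z_t`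
for `t` near `t₀` are non-empty (`eventually_nonempty_inter_fibreSlice`, Remmert), a generic one is of pure
dimension `q + 1` with class `± i₀^*[Z]` (generic fibre class), and the class of a non-empty analytic subset is
non-zero. [cite: Fulton1998, §10.2 Prop. 10.2 and §11.1] [cite: Fischer1976, §3.9 Prop.] -/
theorem compContinuousLinearMap_inl_analyticCycleClass_ne_zero_of_codim_le (hE₂ : 0 < finrank ℂ E₂) {n : ℕ}
    (e : Fin n ≃ ι₁ ⊕ ι₂) (hk : 2 * (q + 1 + finrank ℂ E₂) + 2 * p = n)
    {Z : Set (ComplexTorus (prodPeriodL2 Φ₁ Φ₂))}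
    (hZ : HasPureDim 𝓘(ℂ, WithLp 2 (E₁ × E₂)) Z (q + 1 + finrank ℂ E₂)) {x₀ : ComplexTorus Φ₁}
    {t₀ : ComplexTorus Φ₂} (hx₀ : (prodHomeomorphL2 Φ₁ Φ₂).symm (x₀, t₀) ∈ Z)
    (hdim : ∀ᶠ x in 𝓝 x₀, (prodHomeomorphL2 Φ₁ Φ₂).symm (x, t₀) ∈ Z → ∀ c,
      IsRegularPointOfCodim 𝓘(ℂ, E₁) {x : ComplexTorus Φ₁ | (prodHomeomorphL2 Φ₁ Φ₂).symm (x, t₀) ∈ Z} c x →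
        finrank ℂ E₁ ≤ c + (q + 1)) :
    (analyticCycleClass (prodPeriodL2 Φ₁ Φ₂) e hk hZ).compContinuousLinearMap
      (realRep Φ₁ (prodPeriodL2 Φ₁ Φ₂) (inlMatrix ι₁ ι₂)) ≠ 0 := by
  -- an enumeration of the lattice basis of `X₁` in the right degree
  have hn : n = Fintype.card ι₁ + Fintype.card ι₂ := by
    rw [← Fintype.card_sum, ← Fintype.card_fin n]; exact Fintype.card_congr e
  have hng₂ : finrank ℂ E₂ * 2 = Fintype.card ι₂ := by
    rw [← Module.finrank_fintype_fun_eq_card (R := ℝ), Φ₂.toLinearEquiv.finrank_eq, finrank_real_of_complex, mul_comm]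
  have h₁ : 2 * (q + 1) + 2 * p = Fintype.card ι₁ := by omega
  set e₁' : Fin (Fintype.card ι₁) ≃ ι₁ := (Fintype.equivFin ι₁).symm with he₁'
  have hcl := ae_volume_setCycleClass_fibreSlice_eq_inl_pullback Φ₁ Φ₂ e₁' hE₂ e (Nat.succ_pos q) h₁ hk hZ
  have hep := ae_volume_fibreSlice_eq_empty_or_hasPureDim Φ₁ Φ₂ (q := q + 1) hZ
  -- fibres near `t₀` are non-empty
  have hne : ∀ᶠ t in 𝓝 t₀, {x : ComplexTorus Φ₁ | (prodHomeomorphL2 Φ₁ Φ₂).symm (x, t) ∈ Z}.Nonempty := by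
    have h := eventually_nonempty_inter_fibreSlice Φ₁ Φ₂ hZ hx₀ hdim univ_mem
    simpa only [univ_inter] using h
  obtain ⟨N₀, hN₀, hN₀o, h0N₀⟩ := _root_.mem_nhds_iff.1 hne
  -- a generic nearby fibre: non-empty, of pure dimension `q + 1`, with class `± i₀^*[Z]`
  obtain ⟨t, htN, hte, htc⟩ := (Measure.dense_of_ae (hep.and hcl)).inter_open_nonempty N₀ hN₀o ⟨t₀, h0N₀⟩
  have hZt : HasPureDim 𝓘(ℂ, E₁) {x : ComplexTorus Φ₁ | (prodHomeomorphL2 Φ₁ Φ₂).symm (x, t) ∈ Z} (q + 1) :=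
    hte.resolve_left (hN₀ htN).ne_empty
  intro h0
  rw [h0, smul_zero, setCycleClass_of_hasPureDim Φ₁ e₁' h₁ hZt] at htc
  exact analyticCycleClass_ne_zero Φ₁ e₁' h₁ hZt htc

open Classical in
/-- **One fibre point of the expected dimension forces `pr₂(Z) = X₂`**: every fibre `Z_t` is non-empty
(`i₀^*[Z] ≠ 0`, `fibreSlice_nonempty_of_ne_zero`). [cite: Fulton1998, §10.1 Cor. 10.1, §10.2 Prop. 10.2 and §11.1]
[cite: Fischer1976, §3.9 Prop.] -/
theorem forall_fibreSlice_nonempty_of_codim_le (hE₂ : 0 < finrank ℂ E₂)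
    {Z : Set (ComplexTorus (prodPeriodL2 Φ₁ Φ₂))}
    (hZ : HasPureDim 𝓘(ℂ, WithLp 2 (E₁ × E₂)) Z (q + 1 + finrank ℂ E₂)) {x₀ : ComplexTorus Φ₁}
    {t₀ : ComplexTorus Φ₂} (hx₀ : (prodHomeomorphL2 Φ₁ Φ₂).symm (x₀, t₀) ∈ Z)
    (hdim : ∀ᶠ x in 𝓝 x₀, (prodHomeomorphL2 Φ₁ Φ₂).symm (x, t₀) ∈ Z → ∀ c,
      IsRegularPointOfCodim 𝓘(ℂ, E₁) {x : ComplexTorus Φ₁ | (prodHomeomorphL2 Φ₁ Φ₂).symm (x, t₀) ∈ Z} c x →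
        finrank ℂ E₁ ≤ c + (q + 1))
    (t : ComplexTorus Φ₂) : {x : ComplexTorus Φ₁ | (prodHomeomorphL2 Φ₁ Φ₂).symm (x, t) ∈ Z}.Nonempty := by
  -- an enumeration of the full lattice basis and the degree of `[Z]`
  have hng₁ : finrank ℂ E₁ * 2 = Fintype.card ι₁ := by
    rw [← Module.finrank_fintype_fun_eq_card (R := ℝ), Φ₁.toLinearEquiv.finrank_eq, finrank_real_of_complex, mul_comm]
  have hng₂ : finrank ℂ E₂ * 2 = Fintype.card ι₂ := by
    rw [← Module.finrank_fintype_fun_eq_card (R := ℝ), Φ₂.toLinearEquiv.finrank_eq, finrank_real_of_complex, mul_comm]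
  have hle : q + 1 + finrank ℂ E₂ ≤ finrank ℂ (WithLp 2 (E₁ × E₂)) := hZ.le_finrank
  have hdimVW : finrank ℂ (WithLp 2 (E₁ × E₂)) = finrank ℂ E₁ + finrank ℂ E₂ := by
    rw [(WithLp.prodContinuousLinearEquiv 2 ℂ E₁ E₂).toLinearEquiv.finrank_eq, Module.finrank_prod]
  set e : Fin (Fintype.card ι₁ + Fintype.card ι₂) ≃ ι₁ ⊕ ι₂ :=
    (finSumFinEquiv.symm.trans ((Fintype.equivFin ι₁).symm.sumCongr (Fintype.equivFin ι₂).symm)) with he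
  have hk : 2 * (q + 1 + finrank ℂ E₂) + 2 * (finrank ℂ E₁ - (q + 1)) = Fintype.card ι₁ + Fintype.card ι₂ := by
    omega
  exact fibreSlice_nonempty_of_ne_zero Φ₁ Φ₂ hE₂ e hk hZ
    (compContinuousLinearMap_inl_analyticCycleClass_ne_zero_of_codim_le Φ₁ Φ₂ hE₂ e hk hZ hx₀ hdim) t

open Classical in
/-- **THE SPECIALIZED CYCLE CONTAINS EVERY POINT OF THE SPECIAL FIBRE OF THE EXPECTED DIMENSION.** For
`Z ⊆ X₁ × X₂` closed analytic of pure dimension `q + 1 + dim X₂` (`dim X₂ > 0`) and `t₀ ∈ X₂` there is an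
effective `(q+1)`-cycle `S ≥ 0` of `X₁` with `|S| ⊆ Z_{t₀}`, `cl_{e₁}(S) = sign(e₁) sign(e) · i₀^*[Z]_e`, and
**`x ∈ |S|` for every point `x` of `Z_{t₀}` at which the fibre has dimension `≤ q + 1`** (the proper components
of the special fibre carry the limit cycle, Fulton §11.1). If there is no such point this is §2; otherwise `S` is
the limit of generic non-empty nearby fibres as in §5 and the local form `mem_closure_iUnion_fibreSlice` puts every
such point in the limit set. [cite: Fulton1998, §10.1 Cor. 10.1, §10.2 Prop. 10.2 and §11.1]
[cite: Fischer1976, §3.9 Prop.] [cite: Chirka1989, §16.1 Prop. 1] -/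
theorem exists_effectiveCycle_fibreSlice_eq_inl_pullback_support_supset (hE₂ : 0 < finrank ℂ E₂) {n : ℕ}
    (e : Fin n ≃ ι₁ ⊕ ι₂) (h₁ : 2 * (q + 1) + 2 * p = n₁) (hk : 2 * (q + 1 + finrank ℂ E₂) + 2 * p = n)
    {Z : Set (ComplexTorus (prodPeriodL2 Φ₁ Φ₂))}
    (hZ : HasPureDim 𝓘(ℂ, WithLp 2 (E₁ × E₂)) Z (q + 1 + finrank ℂ E₂)) (t₀ : ComplexTorus Φ₂) :
    ∃ S : HolomorphicChain 𝓘(ℂ, E₁) (ComplexTorus Φ₁) (q + 1), (∀ W, 0 ≤ S.mult W) ∧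
      S.support ⊆ {x : ComplexTorus Φ₁ | (prodHomeomorphL2 Φ₁ Φ₂).symm (x, t₀) ∈ Z} ∧
      (∀ x₀, (prodHomeomorphL2 Φ₁ Φ₂).symm (x₀, t₀) ∈ Z →
        (∀ᶠ x in 𝓝 x₀, (prodHomeomorphL2 Φ₁ Φ₂).symm (x, t₀) ∈ Z → ∀ c,
          IsRegularPointOfCodim 𝓘(ℂ, E₁) {x : ComplexTorus Φ₁ | (prodHomeomorphL2 Φ₁ Φ₂).symm (x, t₀) ∈ Z} c x →
            finrank ℂ E₁ ≤ c + (q + 1)) → x₀ ∈ S.support) ∧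
        chainCycleClass Φ₁ e₁ h₁ S =
          ((orientationSign Φ₁ e₁ * orientationSign (prodPeriod Φ₁ Φ₂) e : ℤ) : ℂ) •
            (analyticCycleClass (prodPeriodL2 Φ₁ Φ₂) e hk hZ).compContinuousLinearMap
              (realRep Φ₁ (prodPeriodL2 Φ₁ Φ₂) (inlMatrix ι₁ ι₂)) := by
  by_cases hprop : ∃ x₀, (prodHomeomorphL2 Φ₁ Φ₂).symm (x₀, t₀) ∈ Z ∧
      ∀ᶠ x in 𝓝 x₀, (prodHomeomorphL2 Φ₁ Φ₂).symm (x, t₀) ∈ Z → ∀ c,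
        IsRegularPointOfCodim 𝓘(ℂ, E₁) {x : ComplexTorus Φ₁ | (prodHomeomorphL2 Φ₁ Φ₂).symm (x, t₀) ∈ Z} c x →
          finrank ℂ E₁ ≤ c + (q + 1)
  swap
  · -- no proper point: §2
    simp only [not_exists, not_and] at hprop
    obtain ⟨S, hS0, hsupp, hcl⟩ := exists_effectiveCycle_fibreSlice_eq_inl_pullback Φ₁ Φ₂ e₁ hE₂ e h₁ hk hZ t₀
    exact ⟨S, hS0, hsupp, fun x₀ hx₀ hd ↦ absurd hd (hprop x₀ hx₀), hcl⟩
  obtain ⟨x₀, hx₀, hdim₀⟩ := hprop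
  -- the generic class
  have hcl := ae_volume_setCycleClass_fibreSlice_eq_inl_pullback Φ₁ Φ₂ e₁ hE₂ e (Nat.succ_pos q) h₁ hk hZ
  -- fibres near `t₀` are non-empty (Remmert at the proper point `x₀`)
  have hne : ∀ᶠ t in 𝓝 t₀, {x : ComplexTorus Φ₁ | (prodHomeomorphL2 Φ₁ Φ₂).symm (x, t) ∈ Z}.Nonempty := by
    have h := eventually_nonempty_inter_fibreSlice Φ₁ Φ₂ hZ hx₀ hdim₀ univ_mem
    simpa only [univ_inter] using h
  obtain ⟨N₀, hN₀, hN₀o, h0N₀⟩ := _root_.mem_nhds_iff.1 hne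
  -- a.e. fibre is of pure dimension `q + 1` (the a.e.-empty alternative contradicts `hne` by density)
  have hpure : ∀ᵐ t ∂(volume : Measure (ComplexTorus Φ₂)),
      HasPureDim 𝓘(ℂ, E₁) {x : ComplexTorus Φ₁ | (prodHomeomorphL2 Φ₁ Φ₂).symm (x, t) ∈ Z} (q + 1) := by
    rcases ae_volume_fibreSlice_eq_empty_or_ae_volume_hasPureDim Φ₁ Φ₂ e₁ (p := p) (Nat.succ_pos q) h₁ hZ
      with h | h
    · exfalso
      obtain ⟨t, htN, ht⟩ := (Measure.dense_of_ae h).inter_open_nonempty N₀ hN₀o ⟨t₀, h0N₀⟩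
      exact (hN₀ htN).ne_empty ht
    · exact h
  have hdense := Measure.dense_of_ae (hpure.and hcl)
  obtain ⟨t, htG, ht0⟩ := mem_closure_iff_seq_limit.1 (hdense t₀)
  have hZt : ∀ j, HasPureDim 𝓘(ℂ, E₁)
      {x : ComplexTorus Φ₁ | (prodHomeomorphL2 Φ₁ Φ₂).symm (x, t j) ∈ Z} (q + 1) := fun j ↦ (htG j).1
  have hclass : ∀ j, analyticCycleClass Φ₁ e₁ h₁ (hZt j) =
      ((orientationSign Φ₁ e₁ * orientationSign (prodPeriod Φ₁ Φ₂) e : ℤ) : ℂ) •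
        (analyticCycleClass (prodPeriodL2 Φ₁ Φ₂) e hk hZ).compContinuousLinearMap
          (realRep Φ₁ (prodPeriodL2 Φ₁ Φ₂) (inlMatrix ι₁ ι₂)) := by
    intro j
    rw [← setCycleClass_of_hasPureDim Φ₁ e₁ h₁ (hZt j)]
    exact (htG j).2
  -- constant volume (Wirtinger)
  obtain ⟨V, hV⟩ : ∃ V : ℝ, ∀ j,
      (μHE[2 * (q + 1)] : Measure E₁).real (periodBox Φ₁ 0 ∩ (analyticChain Φ₁ (hZt j)).carrier) = V := by
    refine ⟨(poincarePairing Φ₁ e₁ h₁ (ofRealCLM.compContinuousAlternatingMap (kaehlerPow (q + 1)))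
      (((orientationSign Φ₁ e₁ * orientationSign (prodPeriod Φ₁ Φ₂) e : ℤ) : ℂ) •
        (analyticCycleClass (prodPeriodL2 Φ₁ Φ₂) e hk hZ).compContinuousLinearMap
          (realRep Φ₁ (prodPeriodL2 Φ₁ Φ₂) (inlMatrix ι₁ ι₂)))).re, fun j ↦ ?_⟩
    have h := poincarePairing_kaehlerPow_analyticCycleClass Φ₁ e₁ h₁ (hZt j)
    rw [hclass j] at h
    rw [h, Complex.ofReal_re]
  have hvol : ∀ j, (μHE[2 * (q + 1)] : Measure E₁)
      (cover Φ₁ ⁻¹' {x : ComplexTorus Φ₁ | (prodHomeomorphL2 Φ₁ Φ₂).symm (x, t j) ∈ Z} ∩ periodBox Φ₁ 0) ≤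
        ENNReal.ofReal V := by
    intro j
    have heq : (μHE[2 * (q + 1)] : Measure E₁)
        (cover Φ₁ ⁻¹' {x : ComplexTorus Φ₁ | (prodHomeomorphL2 Φ₁ Φ₂).symm (x, t j) ∈ Z} ∩ periodBox Φ₁ 0) =
        (μHE[2 * (q + 1)] : Measure E₁) (periodBox Φ₁ 0 ∩ (analyticChain Φ₁ (hZt j)).carrier) := by
      rw [← image_val_liftSet, analyticChain,
        HolomorphicChain.measure_image_inter_eq_carrier_inter (hasPureDim_liftSet Φ₁ (hZt j)), inter_comm]
    rw [heq, ← ENNReal.ofReal_toReal (measure_periodBox_inter_carrier_lt_top Φ₁ (hZt j) 0).ne, ← measureReal_def,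
      hV j]
  -- Bishop
  obtain ⟨κ, S, hκ, hS0, -, hsupp, hclS, -⟩ :=
    exists_subseq_effectiveCycle_of_measure_le Φ₁ hZt e₁ h₁ ENNReal.ofReal_lt_top hvol
  refine ⟨S, hS0, fun z hz ↦ ?_, fun x hx hdx ↦ ?_, ?_⟩
  · have hC : IsClosed {w : ComplexTorus Φ₁ × ComplexTorus Φ₂ | (prodHomeomorphL2 Φ₁ Φ₂).symm w ∈ Z} :=
      hZ.isAnalyticSet.isClosed.preimage (prodHomeomorphL2 Φ₁ Φ₂).symm.continuous
    exact mem_fibre_of_forall_mem_closure_iUnion_fibre hC (ht0.comp hκ.tendsto_atTop) ((hsupp z).1 hz)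
  · -- a proper point of the special fibre is a limit point of the generic fibres (Remmert, local form)
    exact (hsupp x).2 fun N ↦ mem_closure_iUnion_fibreSlice Φ₁ Φ₂ hZ hx hdx (ht0.comp hκ.tendsto_atTop) N
  · obtain ⟨j, hj⟩ := hclS.exists
    rw [← hj, hclass]

end ProperFibrePoints

/-! ### §7 `i₀^*[Z] ≠ 0 ⟺ pr₂(Z) = X₂` and `i₁^*[Z] ≠ 0 ⟺ pr₁(Z) = X₁` -/

section Surjective

variable {ι₁ ι₂ : Type*} [Fintype ι₁] [Fintype ι₂] [DecidableEq ι₁] [DecidableEq ι₂]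
  {E₁ : Type u} [NormedAddCommGroup E₁] [InnerProductSpace ℂ E₁] [FiniteDimensional ℂ E₁]
  [MeasurableSpace E₁] [BorelSpace E₁]
  {E₂ : Type u} [NormedAddCommGroup E₂] [InnerProductSpace ℂ E₂] [FiniteDimensional ℂ E₂]
  [MeasurableSpace E₂] [BorelSpace E₂]
  (Φ₁ : (ι₁ → ℝ) ≃L[ℝ] E₁) (Φ₂ : (ι₂ → ℝ) ≃L[ℝ] E₂) {n₁ : ℕ} (e₁ : Fin n₁ ≃ ι₁) {p q : ℕ}

open Classical in
/-- **`i₀^*[Z]_e ≠ 0` IFF EVERY FIBRE `Z_t` IS NON-EMPTY (`pr₂(Z) = X₂`)**, for `Z ⊆ X₁ × X₂` closed analytic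
of pure dimension `q + 1 + dim X₂`, `dim X₂ > 0`. `⟹`: §2. `⟸`: a.e. fibre is empty or of pure dimension
`q + 1` (`ae_volume_fibreSlice_eq_empty_or_hasPureDim`), hence of pure dimension `q + 1`, and carries the
class `± i₀^*[Z]` (generic fibre class), which is therefore the non-zero class of a non-empty analytic subset.
Fulton, Cor. 10.1 / Prop. 10.2: the fibre classes of a family over a connected base agree ("conservation of
number"). [cite: Fulton1998, §10.1 Cor. 10.1 and §10.2 Prop. 10.2] [cite: Chirka1989, §16.1 Prop. 1] -/
theorem compContinuousLinearMap_inl_analyticCycleClass_ne_zero_iff_forall_fibreSlice_nonempty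
    (hE₂ : 0 < finrank ℂ E₂) {n : ℕ} (e : Fin n ≃ ι₁ ⊕ ι₂) (hk : 2 * (q + 1 + finrank ℂ E₂) + 2 * p = n)
    {Z : Set (ComplexTorus (prodPeriodL2 Φ₁ Φ₂))}
    (hZ : HasPureDim 𝓘(ℂ, WithLp 2 (E₁ × E₂)) Z (q + 1 + finrank ℂ E₂)) :
    (analyticCycleClass (prodPeriodL2 Φ₁ Φ₂) e hk hZ).compContinuousLinearMap
        (realRep Φ₁ (prodPeriodL2 Φ₁ Φ₂) (inlMatrix ι₁ ι₂)) ≠ 0 ↔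
      ∀ t : ComplexTorus Φ₂, {x : ComplexTorus Φ₁ | (prodHomeomorphL2 Φ₁ Φ₂).symm (x, t) ∈ Z}.Nonempty := by
  refine ⟨fun hne t ↦ fibreSlice_nonempty_of_ne_zero Φ₁ Φ₂ hE₂ e hk hZ hne t, fun hall ↦ ?_⟩
  -- an enumeration of the lattice basis of `X₁` in the right degree
  have hn : n = Fintype.card ι₁ + Fintype.card ι₂ := by
    rw [← Fintype.card_sum, ← Fintype.card_fin n]; exact Fintype.card_congr e
  have hng₂ : finrank ℂ E₂ * 2 = Fintype.card ι₂ := by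
    rw [← Module.finrank_fintype_fun_eq_card (R := ℝ), Φ₂.toLinearEquiv.finrank_eq, finrank_real_of_complex, mul_comm]
  have h₁ : 2 * (q + 1) + 2 * p = Fintype.card ι₁ := by omega
  set e₁' : Fin (Fintype.card ι₁) ≃ ι₁ := (Fintype.equivFin ι₁).symm with he₁'
  have hcl := ae_volume_setCycleClass_fibreSlice_eq_inl_pullback Φ₁ Φ₂ e₁' hE₂ e (Nat.succ_pos q) h₁ hk hZ
  have hep := ae_volume_fibreSlice_eq_empty_or_hasPureDim Φ₁ Φ₂ (q := q + 1) hZ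
  obtain ⟨t, hte, htc⟩ := (hep.and hcl).exists
  have hZt : HasPureDim 𝓘(ℂ, E₁) {x : ComplexTorus Φ₁ | (prodHomeomorphL2 Φ₁ Φ₂).symm (x, t) ∈ Z} (q + 1) :=
    hte.resolve_left (hall t).ne_empty
  intro h0
  rw [h0, smul_zero, setCycleClass_of_hasPureDim Φ₁ e₁' h₁ hZt] at htc
  exact analyticCycleClass_ne_zero Φ₁ e₁' h₁ hZt htc

open Classical in
/-- **`K_0[Z] ≠ 0 ⟺ pr₂(Z) = X₂`** (every fibre non-empty), for `Z ⊆ X₁ × X₂` closed analytic of pure dimension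
`q + 1 + dim X₂`. [cite: Fulton1998, §10.1 Cor. 10.1 and §10.2 Prop. 10.2]
[cite: Lange2023AbelianVarietiesComplex, §6.3.3 (6.14) and Prop. 6.3.8] -/
theorem kunnethComponent_zero_ne_zero_iff_forall_fibreSlice_nonempty (hE₂ : 0 < finrank ℂ E₂) {n₂ : ℕ}
    (e₂ : Fin n₂ ≃ ι₂) (hk : 2 * (q + 1 + finrank ℂ E₂) + 2 * p = n₁ + n₂)
    {Z : Set (ComplexTorus (prodPeriodL2 Φ₁ Φ₂))}
    (hZ : HasPureDim 𝓘(ℂ, WithLp 2 (E₁ × E₂)) Z (q + 1 + finrank ℂ E₂)) :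
    (kunnethComponent 0 ((analyticCycleClass (prodPeriodL2 Φ₁ Φ₂) (sumEnum e₁ e₂) hk hZ).compContinuousLinearMap
        ((WithLp.prodContinuousLinearEquiv 2 ℝ E₁ E₂).symm : E₁ × E₂ →L[ℝ] WithLp 2 (E₁ × E₂)))).compContinuousLinearMap
      (WithLp.prodContinuousLinearEquiv 2 ℝ E₁ E₂ : WithLp 2 (E₁ × E₂) →L[ℝ] E₁ × E₂) ≠ 0 ↔
      ∀ t : ComplexTorus Φ₂, {x : ComplexTorus Φ₁ | (prodHomeomorphL2 Φ₁ Φ₂).symm (x, t) ∈ Z}.Nonempty := by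
  rw [Ne, kunnethComponent_zero_compContinuousLinearMap_eq_zero_iff Φ₁ Φ₂]
  exact compContinuousLinearMap_inl_analyticCycleClass_ne_zero_iff_forall_fibreSlice_nonempty Φ₁ Φ₂ hE₂
    (sumEnum e₁ e₂) hk hZ

open Classical in
/-- **`i₁^*[Z] ≠ 0` IFF EVERY SLICE `Zˢ = {y | (s, y) ∈ Z}` IS NON-EMPTY (`pr₁(Z) = X₁`)**, for `Z ⊆ X₁ × X₂`
closed analytic of pure dimension `q + 1 + dim X₁`, `dim X₁ > 0` (the previous statement for the transpose
`ᵗZ ⊆ X₂ × X₁`, through `smul_compContinuousLinearMap_inl_analyticCycleClass_preimage_swap`).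
[cite: Fulton1998, §10.1 Cor. 10.1 and §10.2 Prop. 10.2] [cite: Lange2023AbelianVarietiesComplex, §6.2.2 p. 304] -/
theorem compContinuousLinearMap_inr_analyticCycleClass_ne_zero_iff_forall_fstSlice_nonempty
    (hE₁ : 0 < finrank ℂ E₁) {n₂ : ℕ} (e₂ : Fin n₂ ≃ ι₂) (hk : 2 * (q + 1 + finrank ℂ E₁) + 2 * p = n₁ + n₂)
    {Z : Set (ComplexTorus (prodPeriodL2 Φ₁ Φ₂))}
    (hZ : HasPureDim 𝓘(ℂ, WithLp 2 (E₁ × E₂)) Z (q + 1 + finrank ℂ E₁)) :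
    (analyticCycleClass (prodPeriodL2 Φ₁ Φ₂) (sumEnum e₁ e₂) hk hZ).compContinuousLinearMap
        (realRep Φ₂ (prodPeriodL2 Φ₁ Φ₂) (inrMatrix ι₁ ι₂)) ≠ 0 ↔
      ∀ s : ComplexTorus Φ₁, {y : ComplexTorus Φ₂ | (prodHomeomorphL2 Φ₁ Φ₂).symm (s, y) ∈ Z}.Nonempty := by
  have hZt : HasPureDim 𝓘(ℂ, WithLp 2 (E₂ × E₁))
      (mapMatrix (prodPeriodL2 Φ₂ Φ₁) (prodPeriodL2 Φ₁ Φ₂)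
        (Matrix.fromBlocks (0 : Matrix ι₁ ι₂ ℤ) (1 : Matrix ι₁ ι₁ ℤ) (1 : Matrix ι₂ ι₂ ℤ) (0 : Matrix ι₂ ι₁ ℤ)) ⁻¹' Z)
      (q + 1 + finrank ℂ E₁) :=
    (isIsogeny_swap Φ₂ Φ₁).hasPureDim_preimage (prodPeriodL2 Φ₂ Φ₁) (prodPeriodL2 Φ₁ Φ₂) hZ
  have hk' : 2 * (q + 1 + finrank ℂ E₁) + 2 * p = n₂ + n₁ := by omega
  have key := compContinuousLinearMap_inl_analyticCycleClass_ne_zero_iff_forall_fibreSlice_nonempty Φ₂ Φ₁ hE₁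
    (sumEnum e₂ e₁) hk' hZt
  simp_rw [fibreSlice_preimage_swap_eq] at key
  rw [← key]
  -- the two restriction classes differ by signs `±1`
  have hT := smul_compContinuousLinearMap_inl_analyticCycleClass_preimage_swap Φ₁ Φ₂ e₁ e₂ hk hk' hZ
  have hs₁ : (orientationSign Φ₁ e₁ : ℂ) * orientationSign Φ₁ e₁ = 1 := by
    exact_mod_cast orientationSign_mul_self Φ₁ e₁
  have hs₂ : ((orientationSign Φ₂ e₂ * orientationSign (prodPeriod Φ₂ Φ₁) (sumEnum e₂ e₁) : ℤ) : ℂ) *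
      ((orientationSign Φ₂ e₂ * orientationSign (prodPeriod Φ₂ Φ₁) (sumEnum e₂ e₁) : ℤ) : ℂ) = 1 := by
    rcases orientationSign_eq_or Φ₂ e₂ with ha | ha <;>
      rcases orientationSign_eq_or (prodPeriod Φ₂ Φ₁) (sumEnum e₂ e₁) with hb | hb <;> simp only [ha, hb] <;> norm_num
  rw [not_iff_not]
  constructor
  · intro h
    rw [h, smul_zero] at hT
    exact (smul_eq_zero_iff_of_mul_self₈ hs₂ _).1 hT
  · intro h
    rw [h, smul_zero] at hT
    exact (smul_eq_zero_iff_of_mul_self₈ hs₁ _).1 hT.symm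

open Classical in
/-- **`K_{2p}[Z] ≠ 0 ⟺ pr₁(Z) = X₁`** (every slice over the first factor non-empty), for `Z ⊆ X₁ × X₂` closed
analytic of pure dimension `q + 1 + dim X₁`. [cite: Fulton1998, §10.1 Cor. 10.1 and §10.2 Prop. 10.2]
[cite: Lange2023AbelianVarietiesComplex, §6.3.3 (6.14) and Prop. 6.3.8] -/
theorem kunnethComponent_self_ne_zero_iff_forall_fstSlice_nonempty (hE₁ : 0 < finrank ℂ E₁) {n₂ : ℕ}
    (e₂ : Fin n₂ ≃ ι₂) (hk : 2 * (q + 1 + finrank ℂ E₁) + 2 * p = n₁ + n₂)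
    {Z : Set (ComplexTorus (prodPeriodL2 Φ₁ Φ₂))}
    (hZ : HasPureDim 𝓘(ℂ, WithLp 2 (E₁ × E₂)) Z (q + 1 + finrank ℂ E₁)) :
    (kunnethComponent (2 * p) ((analyticCycleClass (prodPeriodL2 Φ₁ Φ₂) (sumEnum e₁ e₂) hk hZ).compContinuousLinearMap
        ((WithLp.prodContinuousLinearEquiv 2 ℝ E₁ E₂).symm : E₁ × E₂ →L[ℝ] WithLp 2 (E₁ × E₂)))).compContinuousLinearMap
      (WithLp.prodContinuousLinearEquiv 2 ℝ E₁ E₂ : WithLp 2 (E₁ × E₂) →L[ℝ] E₁ × E₂) ≠ 0 ↔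
      ∀ s : ComplexTorus Φ₁, {y : ComplexTorus Φ₂ | (prodHomeomorphL2 Φ₁ Φ₂).symm (s, y) ∈ Z}.Nonempty := by
  rw [Ne, kunnethComponent_self_compContinuousLinearMap_eq_zero_iff Φ₁ Φ₂]
  exact compContinuousLinearMap_inr_analyticCycleClass_ne_zero_iff_forall_fstSlice_nonempty Φ₁ Φ₂ e₁ hE₁ e₂ hk hZ

end Surjective
end ComplexTorus

end Literature.Geometry.Kaehler
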